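import Literature.Combinatorics.AssociationSchemes.JohnsonSpectrum
import Literature.Computability.Complexity.FourierDegreeAlgebra
import HarnessLib

/-!
# Level-`k` inequalities on a slice of the cube, by transfer from the Bonami lemma

SETTING. Functions on the `t`-subsets `U` of `[n]` ("the slice `C([n],t)`") in the ladder calculus of
`Literature.Combinatorics.AssociationSchemes.JohnsonHarmonics` / `JohnsonSpectrum`: a harmonic
coefficient vector `q` of degree `j` (`IsHarmonic j q`: supported on `j`-sets, killed by the lowering
operator) defines the function `U ↦ zeta q U = Σ_{T ⊆ U} q_T` on every slice, and the functions
`zeta q|_{|U| = t}`, `q` harmonic of degree `j`, make up the eigenspace `V_j` of the Johnson scheme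
`J(n,t)` (MacWilliams–Sloane Ch. 21 §6; Delsarte 1973; Dunkl 1976; Filmus 2016). The **level-`j` weight**
of `f : C([n],t) → ℝ` is `W_j[f] = ‖proj_{V_j} f‖²` (expectation norm), equivalently
`W_j[f] = max_q ⟨f, zeta q⟩² / (C(n,t) · Σ_{|U|=t} (zeta q U)²)` over harmonic `q` of degree `j`.

WHAT IS PROVED (everything; no named facts). For `0 ≤ f ≤ 1` on the `t`-sets with mean
`μ = Σ_{|U|=t} f(U) / C(n,t)`, every harmonic `q` of degree `j ≤ t` with `t + j ≤ n`, and every `r ≥ 1`: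

  `(Σ_{|U|=t} f(U) · zeta q U)^{2r} ≤ μ^{2r−1} · (2r−1)^{rj} · (Λ · Σ_{|U|=t} (zeta q U)²)^r`

(`slice_level_pow_le`, the moment form of the level-`j` inequality, O'Donnell 2014 §9.5 transplanted
to the slice), with the explicit transfer constant
`Λ = transferLambda n t j = 4^{n−j} (t−j)! / (K² · ff(n−2j, t−j))`, `K = transferConst n t j > 0`
(`transferConst`, a sum of ratios of binomial coefficients); consequences: the real-exponent form
`⟨f, zeta q⟩² ≤ μ^{2−1/r} (2r−1)^j · Λ · ‖zeta q‖²` (`slice_level_sq_le`) and the logarithmic form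
`⟨f, zeta q⟩² ≤ Λ · μ² · (e (2 ln(1/μ)/j + 3))^j · ‖zeta q‖²` for `j ≥ 1` (`slice_level_sq_le_log`), i.e.
`W_j[f] ≤ (Λ/C(n,t)) · μ² · (e(2 ln(1/μ)/j + 3))^j`. The factor `Λ/C(n,t)` depends on `(n, t, j)` only
(it is `1` at `j = 0`; numerically (exact rationals, LIT-13 §7) `≈ 1.2^j` at `t = n/2` and slightly ABOVE `3^j`
at the corner `t = n/4` — e.g. `82.1 > 81 = 3⁴` at `(n,t,j) = (64,16,4)`; an earlier version of this aside
said `≤ 3^j`, which is false there: referee erratum NIT-1, 2026-08-26); §6 proves the ABSOLUTE-CONSTANT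
bound `Λ ≤ 16 · 48^j · C(n,t)` on balanced slices `64 ≤ n ≤ 4t`, `2t ≤ n`, `8j ≤ n` (`transferLambda_le`),
whence

  `W_j[f] ≤ 16 · μ² · (48 e (2 ln(1/μ)/j + 3))^j`   (`slice_level_sq_le_log_balanced`, `j ≥ 1`);

§7 gives the PROJECTION FORM: for `f = Σ_{i≤t} zeta p_i` (harmonic layers) the norm of the layer itself obeys
`Σ_{|U|=t} (zeta p_j U)² ≤ Λ μ² (e(2 ln(1/μ)/j+3))^j` (`slice_layer_sq_le_log`, `_balanced`).

The classical printed route to level-`k` bounds on the slice is hypercontractivity of the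
Bernoulli–Laplace semigroup via the log-Sobolev constant of Lee–Yau (1998) and Diaconis–Saloff-Coste
(1996) (as cited in [FilmusMossel2019, Prop. 5.1]); it is NOT followed here.

THE PROOF (elementary transfer; declared deviation from print). Put `F(V)`, `V ⊆ [n]` arbitrary, for
the average of `f` over the `t`-subsets of `V` if `|V| ≥ t` and over the `t`-supersets of `V` if `|V| < t`
(`sliceAvg`); then `0 ≤ F ≤ 1` and `Σ_V F(V) = 2^n μ` (`sum_sliceAvg`). The two LADDER SUMS of a
harmonic `q` of degree `j` — over the `s`-subsets of a `t`-set, `Σ_{V ⊆ U, |V|=s} zeta q V =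
C(t−j, s−j) · zeta q U` (`sum_powersetCard_zeta`, homogeneity suffices), and over its `(t+d)`-supersets,
`Σ_{V ⊇ U, |V|=t+d} zeta q V = (ff(n−t−j, d)/d!) · zeta q U` (`sum_supersets_zeta`, from the tree's
`iterate_down_iterate_up_of_isHarmonic`) — give `Σ_V F(V) · zeta q V = K · Σ_{|U|=t} f(U) zeta q U`
(`sum_sliceAvg_mul_zeta`). On the other hand `V ↦ zeta q V`, read on the cube `{0,1}^n`, is a multilinear
polynomial of degree `j` (`isLevelLE_zeta`), its cube norm is `Σ_V (zeta q V)² = 2^{n−2j} ⟪q,q⟫`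
(`sum_univ_zeta_sq`, slice by slice from the tree's `slice_sum_zeta_mul_zeta_eq`), and the tree's
BONAMI LEMMA for even moments (`IsLevelLE.bonami_even_moment`, O'Donnell Thm. 9.21) together with the
power-mean inequality for the probability vector `F/(2^n μ)` (`avg_mul_pow_le`, the Hölder step of
O'Donnell §9.5 exactly as in the tree's `levelK_pow_le`) bound `(Σ_V F · zeta q)^{2r}`; finally
`Σ_{|U|=t} (zeta q U)² = (ff(n−2j, t−j)/(t−j)!) ⟪q,q⟫` (tree) converts coefficient norms to slice norms.
The absolute constants (§6) come from `K ≥ 3^{−j} 2^n / (4 C(n,t))` — the levels `n/2 ≤ s ≤ 5n/8` alone,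
whose binomial mass is `≥ 2^n/4` for `n ≥ 64` by Chebyshev's inequality (`Σ_s (n−2s)² C(n,s) = n 2^n`,
`sum_choose_mul_sq`, from orthogonality of characters on the cube), each contributing
`C(n−t−j, s−t)/C(s,t) ≥ 3^{−j} C(n,s)/C(n,t)` (`choose_le_transferCoeff_mul`) — and from
`C(n,t)/C(n−2j, t−j) = n^{(2j)}/(t^{(j)} (n−t)^{(j)}) ≤ (64/3)^j` (`three_pow_mul_choose_le`).

Consumer: cell pnp-psdrank (summit PneNP), the "(F1) slice level-k inequality" input of the spectral
non-tightness step for rectangles of (`t`-cuts) × (perfect matchings). No facts, no instances/notation,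
standard axioms. Label: support / instrument (Boolean-function analysis on the slice); nothing here is
about psd rank or P vs NP.

## References
* [ODonnell2014] R. O'Donnell, *Analysis of Boolean Functions*, CUP 2014: §9.1 (Bonami lemma),
  Thm. 9.21, §9.5 (level-k inequalities, the Hölder route) — the cube-side inputs, in the tree as
  `Literature.Computability.Complexity.LowDegree.bonami_even_moment` / `levelK_pow_le`.
* [Filmus2016] Y. Filmus, *An orthogonal basis for functions over a slice of the Boolean hypercube*,
  Electron. J. Combin. 23(1) (2016) P1.23 (held text `paper:arxiv-1406.0142`): Thm. 3.1 (the harmonic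
  degree-`d` spaces are mutually orthogonal under EVERY permutation-invariant measure, arXiv p. 6) and
  Thm. 3.2 (norms of the basis under the slice measure and under `μ_p`, `‖χ_B‖²_{μ_p} = (2p(1−p))^d c_B`,
  arXiv pp. 7–8) — the comparison of slice and cube norms of harmonic polynomials (§2 here).
* [FilmusMossel2019] Y. Filmus, E. Mossel, *Harmonicity and invariance on slices of the Boolean cube*,
  Probab. Theory Related Fields 175 (2019) 721–782, Prop. 5.1 (hypercontractivity on the slice via
  Lee–Yau; held text `paper:arxiv-1507.02713`, p. 16) — the printed (different) route, for comparison.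
* [MacWilliamsSloane1977] F. J. MacWilliams, N. J. A. Sloane, *The Theory of Error-Correcting Codes*,
  Ch. 21 §6 (Johnson scheme) — vocabulary, via `JohnsonSpectrum`.
-/

noncomputable section

open Finset
open scoped BigOperators

namespace Literature.Combinatorics.AssociationSchemes

namespace SliceLevelInequality

open JohnsonHarmonics JohnsonSpectrum
open Literature.Probability.RandomGraphs.LowDegree (walsh sgn)
open Literature.Computability.Complexity.LowDegree (cubeFourierCoeff IsLevelLE)

variable {n : ℕ}

/-! ### §1 Ladder sums of a harmonic polynomial over sub- and supersets -/

/-- `ff a k / k! = C(a, k)` for naturals `a, k` (both sides vanish for `a < k`).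
[cite: Grigoriev2001, §1 (B_k = r(r−1)⋯(r−k+1)/(n(n−1)⋯(n−k+1)), PDF p. 8)] -/
theorem ff_natCast_div_factorial (a k : ℕ) :
    ff (a : ℝ) k / (k.factorial : ℝ) = ((a.choose k : ℕ) : ℝ) := by
  rcases le_or_gt k a with h | h
  · have hk : (k.factorial : ℝ) ≠ 0 := by positivity
    have hak : ((a - k).factorial : ℝ) ≠ 0 := by positivity
    rw [Nat.cast_choose ℝ h, div_eq_div_iff hk (mul_ne_zero hk hak), ← ff_natCast_mul_factorial h]
    ring
  · rw [ff_natCast_of_lt h, Nat.choose_eq_zero_of_lt h, zero_div, Nat.cast_zero]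

/-- The product of ladder eigenvalues met when lowering `d` times from rung `t + d − j` down to rung
`t − j` of a harmonic vector of degree `j ≤ t`:
`Π_{r<d} λ_j(t+d−j−1−r) · (t−j)! = (t+d−j)! · ff(n−t−j, d)`.
[cite: MacWilliamsSloane1977, Ch. 21 §6 Thm. 10 (PDF p. 516)] -/
theorem ladderProd_mul_factorial {j t : ℕ} (hjt : j ≤ t) (d : ℕ) :
    ladderProd n j (t + d - j) d * ((t - j).factorial : ℝ) =
      ((t + d - j).factorial : ℝ) * ff ((n : ℝ) - t - j) d := by
  induction d with
  | zero => simp [ladderProd_zero]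
  | succ d ih =>
    have h1 : t + (d + 1) - j = (t + d - j) + 1 := by omega
    rw [h1, ladderProd_succ, mul_assoc, ih, Nat.factorial_succ, Nat.cast_mul, ff_succ, ladder]
    have h2 : ((t + d - j : ℕ) : ℝ) = (t : ℝ) + d - j := by
      rw [Nat.cast_sub (by omega), Nat.cast_add]
    rw [Nat.cast_add_one, h2]
    ring

/-- **Superset sums of a harmonic polynomial**: for `q` harmonic of degree `j ≤ t` and `|U| = t`,
`Σ_{V ⊇ U, |V| = t + d} zeta q V = (ff(n−t−j, d) / d!) · zeta q U` (`= C(n−t−j, d) · zeta q U` when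
`t + j ≤ n`): the superset-averaging operator acts on the eigenspace `V_j` by a scalar.
[cite: MacWilliamsSloane1977, Ch. 21 §6 Thm. 10 (PDF p. 516)] -/
theorem sum_supersets_zeta {j t : ℕ} (hjt : j ≤ t) {q : Finset (Fin n) → ℝ} (hq : IsHarmonic j q)
    (d : ℕ) {U : Finset (Fin n)} (hU : U.card = t) :
    ∑ V ∈ univ.filter (fun V : Finset (Fin n) => U ⊆ V ∧ V.card = t + d), zeta q V =
      ff ((n : ℝ) - t - j) d / (d.factorial : ℝ) * zeta q U := by
  set v : Finset (Fin n) → ℝ := up^[t + d - j] q with hv_def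
  have hv : IsHomog (t + d) v := by
    have := isHomog_iterate_up hq.1 (t + d - j)
    rwa [show j + (t + d - j) = t + d by omega] at this
  -- `(down^[d] v) U = d! Σ_{V ⊇ U} v V` and `v V = (t+d−j)! zeta q V`
  have h1 := iterate_down_apply_of_isHomog (r := t) (s := d) hv hU
  have h2 : ∀ V ∈ univ.filter (fun V : Finset (Fin n) => U ⊆ V ∧ V.card = t + d),
      v V = ((t + d - j).factorial : ℝ) * zeta q V := by
    intro V hV
    have hVc : V.card = j + (t + d - j) := by rw [(mem_filter.1 hV).2.2]; omega
    exact iterate_up_apply_of_isHomog hq.1 hVc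
  rw [sum_congr rfl h2, ← mul_sum] at h1
  -- `down^[d] v = ladderProd • up^[t−j] q`, evaluated at `U`
  have h3 : (down^[d] v) U = ladderProd n j (t + d - j) d * (((t - j).factorial : ℝ) * zeta q U) := by
    rw [hv_def, iterate_down_iterate_up_of_isHarmonic hq (by omega : d ≤ t + d - j),
      show t + d - j - d = t - j by omega, Pi.smul_apply, smul_eq_mul,
      iterate_up_apply_of_isHomog hq.1 (by rw [hU]; omega : U.card = j + (t - j))]
  rw [h3, ← mul_assoc, ladderProd_mul_factorial hjt d] at h1
  have hd : ((d.factorial : ℝ)) ≠ 0 := by positivity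
  have htd : (((t + d - j).factorial : ℝ)) ≠ 0 := by positivity
  rw [div_mul_eq_mul_div, eq_div_iff hd]
  have := h1
  -- `d! ((t+d−j)! S) = (t+d−j)! ff · zeta q U`
  have h4 : ((t + d - j).factorial : ℝ) * ((d.factorial : ℝ) *
      ∑ V ∈ univ.filter (fun V : Finset (Fin n) => U ⊆ V ∧ V.card = t + d), zeta q V) =
      ((t + d - j).factorial : ℝ) * (ff ((n : ℝ) - t - j) d * zeta q U) := by
    calc _ = (d.factorial : ℝ) * (((t + d - j).factorial : ℝ) *
          ∑ V ∈ univ.filter (fun V : Finset (Fin n) => U ⊆ V ∧ V.card = t + d), zeta q V) := by ring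
      _ = ((t + d - j).factorial : ℝ) * ff ((n : ℝ) - t - j) d * zeta q U := this.symm
      _ = _ := by ring
  have := mul_left_cancel₀ htd h4
  rw [mul_comm] at this
  exact this

/-- **Subset sums of a homogeneous polynomial**: for `q` homogeneous of degree `j` (`IsHomog j q`),
`j ≤ s ≤ t = |U|`: `Σ_{V ⊆ U, |V| = s} zeta q V = C(t−j, s−j) · zeta q U`.
[cite: MacWilliamsSloane1977, Ch. 21 §6 Problem (11) (PDF p. 516)] -/
theorem sum_powersetCard_zeta {j s t : ℕ} (hjs : j ≤ s) (hst : s ≤ t) {q : Finset (Fin n) → ℝ}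
    (hq : IsHomog j q) {U : Finset (Fin n)} (hU : U.card = t) :
    ∑ V ∈ U.powersetCard s, zeta q V = (((t - j).choose (s - j) : ℕ) : ℝ) * zeta q U := by
  set w : Finset (Fin n) → ℝ := up^[s - j] q with hw_def
  have hw : IsHomog s w := by
    have := isHomog_iterate_up hq (s - j)
    rwa [show j + (s - j) = s by omega] at this
  -- `(up^[t−s] w) U = (t−s)! zeta w U = (t−s)! Σ_{V ⊆ U, |V| = s} w V`
  have h1 : (up^[t - s] w) U = ((t - s).factorial : ℝ) * zeta w U :=
    iterate_up_apply_of_isHomog hw (by rw [hU]; omega)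
  have h2 : zeta w U = ∑ V ∈ U.powersetCard s, ((s - j).factorial : ℝ) * zeta q V := by
    rw [zeta_apply, powersetCard_eq_filter, sum_filter]
    refine sum_congr rfl fun V hV => ?_
    by_cases hVs : V.card = s
    · rw [if_pos hVs, hw_def, iterate_up_apply_of_isHomog hq (by rw [hVs]; omega)]
    · rw [if_neg hVs, hw V hVs]
  -- `up^[t−s] w = up^[t−j] q`, evaluated at `U`
  have h3 : (up^[t - s] w) U = ((t - j).factorial : ℝ) * zeta q U := by
    rw [hw_def, ← Function.iterate_add_apply, show t - s + (s - j) = t - j by omega,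
      iterate_up_apply_of_isHomog hq (by rw [hU]; omega)]
  rw [h1, h2, ← mul_sum] at h3
  have hts : ((t - s).factorial : ℝ) ≠ 0 := by positivity
  have hsj : ((s - j).factorial : ℝ) ≠ 0 := by positivity
  rw [Nat.cast_choose ℝ (by omega : s - j ≤ t - j), show t - j - (s - j) = t - s by omega,
    div_mul_eq_mul_div, eq_div_iff (mul_ne_zero hsj hts)]
  linear_combination h3

/-- Below the degree the subset sums vanish: `Σ_{V ⊆ U, |V| = s} zeta q V = 0` for `s < j`.
[cite: MacWilliamsSloane1977, Ch. 21 §6 Problem (11) (PDF p. 516)] -/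
theorem sum_powersetCard_zeta_eq_zero {j s : ℕ} (hsj : s < j) {q : Finset (Fin n) → ℝ}
    (hq : IsHomog j q) (U : Finset (Fin n)) : ∑ V ∈ U.powersetCard s, zeta q V = 0 :=
  sum_eq_zero fun _ hV => zeta_of_isHomog_of_card_lt hq ((mem_powersetCard.1 hV).2 ▸ hsj)

/-- The number of `(t+d)`-supersets of a `t`-set in `[n]` is `C(n−t, d)` (the case `j = 0` of
`sum_supersets_zeta`). [cite: MacWilliamsSloane1977, Ch. 21 §6 Problem (11) (PDF p. 516)] -/
theorem card_filter_supersets {t : ℕ} (d : ℕ) {U : Finset (Fin n)} (hU : U.card = t) :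
    ((univ.filter (fun V : Finset (Fin n) => U ⊆ V ∧ V.card = t + d)).card : ℝ) =
      (((n - t).choose d : ℕ) : ℝ) := by
  have h0 : IsHarmonic 0 (delta (∅ : Finset (Fin n))) :=
    isHarmonic_of_isHomog_zero (by simpa using isHomog_delta (∅ : Finset (Fin n)))
  have h := sum_supersets_zeta (Nat.zero_le t) h0 d hU
  simp only [zeta_delta, empty_subset, if_true, sum_const, nsmul_eq_mul, mul_one, Nat.cast_zero,
    sub_zero] at h
  have htn : t ≤ n := by
    have := card_le_univ U; rw [Fintype.card_fin] at this; omega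
  rw [h, ← Nat.cast_sub htn, ff_natCast_div_factorial]

/-! ### §2 The cube norm of a harmonic polynomial -/

/-- `Σ_{s ≤ n} σ_j(s) = 2^{n−2j}` for `2j ≤ n`: the slice factors `σ_j(s) = C(n−2j, s−j)` of the
eigenspace `V_j` add up over all slices to a power of two. [cite: Filmus2016, Thm. 3.2 (arXiv pp. 7–8)] -/
theorem sum_sliceFactor {j : ℕ} (h2j : 2 * j ≤ n) :
    ∑ s ∈ range (n + 1), sliceFactor n j s = (2 : ℝ) ^ (n - 2 * j) := by
  have hsplit := sum_range_add_sum_Ico (fun s => sliceFactor n j s) (by omega : j ≤ n + 1)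
  rw [← hsplit]
  have hlow : ∑ s ∈ range j, sliceFactor n j s = 0 :=
    sum_eq_zero fun s hs => by rw [sliceFactor, if_neg (by have := mem_range.1 hs; omega)]
  rw [hlow, zero_add, sum_Ico_eq_sum_range]
  have hterm : ∀ d ∈ range (n + 1 - j), sliceFactor n j (j + d) = (((n - 2 * j).choose d : ℕ) : ℝ) := by
    intro d _
    rw [sliceFactor, if_pos (Nat.le_add_right j d), Nat.add_sub_cancel_left,
      show ((n : ℝ) - 2 * j) = ((n - 2 * j : ℕ) : ℝ) by rw [Nat.cast_sub h2j]; push_cast; ring,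
      ff_natCast_div_factorial]
  rw [sum_congr rfl hterm]
  have hsplit2 := sum_range_add_sum_Ico (fun d => (((n - 2 * j).choose d : ℕ) : ℝ))
    (by omega : n - 2 * j + 1 ≤ n + 1 - j)
  rw [← hsplit2]
  have hhigh : ∑ d ∈ Ico (n - 2 * j + 1) (n + 1 - j), (((n - 2 * j).choose d : ℕ) : ℝ) = 0 :=
    sum_eq_zero fun d hd => by
      rw [Nat.choose_eq_zero_of_lt (by have := (mem_Ico.1 hd).1; omega), Nat.cast_zero]
  rw [hhigh, add_zero]
  exact_mod_cast Nat.sum_range_choose (n - 2 * j)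

/-- Summing over all subsets of `[n]` slice by slice. [folklore] -/
private theorem sum_univ_eq_sum_range_powersetCard (g : Finset (Fin n) → ℝ) :
    ∑ V : Finset (Fin n), g V = ∑ s ∈ range (n + 1), ∑ V ∈ powersetCard s univ, g V := by
  rw [← powerset_univ, powerset_card_disjiUnion, sum_disjiUnion, card_univ, Fintype.card_fin]

/-- **The cube norm of a harmonic polynomial**: for `q` harmonic of degree `j`, `2j ≤ n`,
`Σ_{V ⊆ [n]} (zeta q V)² = 2^{n−2j} ⟪q, q⟫` — i.e. `𝔼_{x ∈ {0,1}^n}[q(x)²] = 4^{−j} Σ_T q_T²`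
(a harmonic multilinear polynomial is invariant under translating all variables by a constant, so
this is its variance in centred `±½`-valued variables). [cite: Filmus2016, Thm. 3.1 and Thm. 3.2 (arXiv pp. 6–8)] -/
theorem sum_univ_zeta_sq {j : ℕ} (h2j : 2 * j ≤ n) {q : Finset (Fin n) → ℝ} (hq : IsHarmonic j q) :
    ∑ V : Finset (Fin n), zeta q V ^ 2 = (2 : ℝ) ^ (n - 2 * j) * ip q q := by
  rw [sum_univ_eq_sum_range_powersetCard]
  have hlev : ∀ s ∈ range (n + 1), ∑ V ∈ powersetCard s univ, zeta q V ^ 2 = sliceFactor n j s * ip q q := by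
    intro s _
    have h := slice_sum_zeta_mul_zeta_eq (s := s) hq hq
    rw [if_pos rfl] at h
    rw [← h]
    exact sum_congr rfl fun _ _ => sq _
  rw [sum_congr rfl hlev, ← sum_mul, sum_sliceFactor h2j]

/-- **The slice norm of a harmonic polynomial** (restated from the tree in the present notation): for
`q` harmonic of degree `j ≤ t`, `Σ_{|U| = t} (zeta q U)² = (ff(n−2j, t−j)/(t−j)!) ⟪q, q⟫`
(`= C(n−2j, t−j) ⟪q,q⟫` for `t + j ≤ n`). [cite: Filmus2016, Thm. 3.2 (arXiv pp. 7–8)] -/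
theorem sum_powersetCard_zeta_sq {j t : ℕ} (hjt : j ≤ t) {q : Finset (Fin n) → ℝ} (hq : IsHarmonic j q) :
    ∑ U ∈ powersetCard t univ, zeta q U ^ 2 =
      ff ((n : ℝ) - 2 * j) (t - j) / ((t - j).factorial : ℝ) * ip q q := by
  have h := slice_sum_zeta_mul_zeta_eq (s := t) hq hq
  rw [if_pos rfl, sliceFactor, if_pos hjt] at h
  rw [← h]
  exact sum_congr rfl fun _ _ => sq _

/-- Falling factorials of naturals are nonnegative. [cite: Grigoriev2001, §1 (B_k = r(r−1)⋯(r−k+1)/(n(n−1)⋯(n−k+1)), PDF p. 8)] -/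
theorem ff_natCast_nonneg (a k : ℕ) : 0 ≤ ff (a : ℝ) k := by
  have h := ff_natCast_div_factorial a k
  have hk : (0 : ℝ) < k.factorial := by positivity
  rw [div_eq_iff hk.ne'] at h
  rw [h]; positivity

/-! ### §3 The averaging operator from the slice to all subsets -/

/-- The `t`-sets "next to" a set `V`: its `t`-subsets if `|V| ≥ t`, its `t`-supersets otherwise.
[cite: ODonnell2014, §9.5] -/
def nbrs (t : ℕ) (V : Finset (Fin n)) : Finset (Finset (Fin n)) :=
  if t ≤ V.card then V.powersetCard t else univ.filter (fun U : Finset (Fin n) => V ⊆ U ∧ U.card = t)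

/-- **The averaging operator** `f ↦ F`: `F(V)` is the average of `f` over the `t`-sets next to `V`
(`nbrs`). It maps `[0,1]`-valued functions on the `t`-slice to `[0,1]`-valued functions on all of
`2^{[n]}` with the same mean, and acts on each eigenspace `V_j` by a positive scalar
(`sum_sliceAvg_mul_zeta`). [cite: ODonnell2014, §9.5] -/
def sliceAvg (t : ℕ) (f : Finset (Fin n) → ℝ) (V : Finset (Fin n)) : ℝ :=
  (∑ U ∈ nbrs t V, f U) / ((nbrs t V).card : ℝ)

/-- The mean `μ = Σ_{|U| = t} f(U) / C(n,t)` of `f` on the `t`-slice. [cite: ODonnell2014, §9.5] -/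
def sliceMean (n t : ℕ) (f : Finset (Fin n) → ℝ) : ℝ :=
  (∑ U ∈ powersetCard t univ, f U) / ((n.choose t : ℕ) : ℝ)

/-- Members of `nbrs t V` are `t`-sets. [folklore] -/
private theorem card_eq_of_mem_nbrs {t : ℕ} {V U : Finset (Fin n)} (hU : U ∈ nbrs t V) : U.card = t := by
  unfold nbrs at hU
  split_ifs at hU with h
  · exact (mem_powersetCard.1 hU).2
  · exact (mem_filter.1 hU).2.2

/-- `0 ≤ F` for `f ≥ 0` on the `t`-sets. [cite: ODonnell2014, §9.5] -/
theorem sliceAvg_nonneg {t : ℕ} {f : Finset (Fin n) → ℝ} (hf0 : ∀ U : Finset (Fin n), U.card = t → 0 ≤ f U)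
    (V : Finset (Fin n)) : 0 ≤ sliceAvg t f V :=
  div_nonneg (sum_nonneg fun U hU => hf0 U (card_eq_of_mem_nbrs hU)) (Nat.cast_nonneg _)

/-- `F ≤ 1` for `f ≤ 1` on the `t`-sets. [cite: ODonnell2014, §9.5] -/
theorem sliceAvg_le_one {t : ℕ} {f : Finset (Fin n) → ℝ} (hf1 : ∀ U : Finset (Fin n), U.card = t → f U ≤ 1)
    (V : Finset (Fin n)) : sliceAvg t f V ≤ 1 := by
  unfold sliceAvg
  rcases Nat.eq_zero_or_pos (nbrs t V).card with h | h
  · rw [h, Nat.cast_zero, div_zero]; exact zero_le_one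
  · rw [div_le_one (by exact_mod_cast h)]
    calc ∑ U ∈ nbrs t V, f U ≤ ∑ U ∈ nbrs t V, (1 : ℝ) := sum_le_sum fun U hU => hf1 U (card_eq_of_mem_nbrs hU)
      _ = ((nbrs t V).card : ℝ) := by simp

/-- Level-wise double counting, `|V| = s ≥ t`: `Σ_{|V|=s} F(V) φ(V) = C(s,t)^{-1} Σ_{|U|=t} f(U) Σ_{V ⊇ U, |V| = s} φ(V)`.
[folklore] -/
private theorem sum_powersetCard_sliceAvg_mul_of_le {t s : ℕ} (hts : t ≤ s) (f φ : Finset (Fin n) → ℝ) :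
    ∑ V ∈ powersetCard s univ, sliceAvg t f V * φ V =
      ((s.choose t : ℕ) : ℝ)⁻¹ * ∑ U ∈ powersetCard t univ,
        f U * ∑ V ∈ univ.filter (fun V : Finset (Fin n) => U ⊆ V ∧ V.card = t + (s - t)), φ V := by
  have h1 : ∀ V ∈ powersetCard s univ, sliceAvg t f V * φ V =
      ((s.choose t : ℕ) : ℝ)⁻¹ * ∑ U ∈ V.powersetCard t, f U * φ V := by
    intro V hV
    have hVs : V.card = s := (mem_powersetCard.1 hV).2
    rw [sliceAvg, nbrs, if_pos (hVs ▸ hts), card_powersetCard, hVs, div_eq_mul_inv, mul_right_comm,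
      sum_mul, mul_comm]
  rw [sum_congr rfl h1, ← mul_sum]
  congr 1
  rw [sum_comm' (t' := powersetCard t univ)
    (s' := fun U => univ.filter (fun V : Finset (Fin n) => U ⊆ V ∧ V.card = t + (s - t)))]
  · exact sum_congr rfl fun U _ => by rw [mul_sum]
  · intro V U
    simp only [mem_powersetCard, subset_univ, true_and, mem_filter, mem_univ, Nat.add_sub_cancel' hts]
    tauto

/-- Level-wise double counting, `|V| = s < t`: `Σ_{|V|=s} F(V) φ(V) = C(n−s, t−s)^{-1} Σ_{|U|=t} f(U) Σ_{V ⊆ U, |V| = s} φ(V)`.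
[folklore] -/
private theorem sum_powersetCard_sliceAvg_mul_of_lt {t s : ℕ} (hst : s < t) (f φ : Finset (Fin n) → ℝ) :
    ∑ V ∈ powersetCard s univ, sliceAvg t f V * φ V =
      (((n - s).choose (t - s) : ℕ) : ℝ)⁻¹ * ∑ U ∈ powersetCard t univ, f U * ∑ V ∈ U.powersetCard s, φ V := by
  have h1 : ∀ V ∈ powersetCard s univ, sliceAvg t f V * φ V =
      (((n - s).choose (t - s) : ℕ) : ℝ)⁻¹ *
        ∑ U ∈ univ.filter (fun U : Finset (Fin n) => V ⊆ U ∧ U.card = t), f U * φ V := by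
    intro V hV
    have hVs : V.card = s := (mem_powersetCard.1 hV).2
    have hc : (((univ.filter (fun U : Finset (Fin n) => V ⊆ U ∧ U.card = t)).card : ℕ) : ℝ) =
        (((n - s).choose (t - s) : ℕ) : ℝ) := by
      have := card_filter_supersets (t - s) hVs
      rwa [Nat.add_sub_cancel' hst.le] at this
    rw [sliceAvg, nbrs, if_neg (by rw [hVs]; omega), hc, div_eq_mul_inv, mul_right_comm, sum_mul, mul_comm]
  rw [sum_congr rfl h1, ← mul_sum]
  congr 1
  rw [sum_comm' (t' := powersetCard t univ) (s' := fun U => U.powersetCard s)]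
  · exact sum_congr rfl fun U _ => by rw [mul_sum]
  · intro V U
    simp only [mem_powersetCard, subset_univ, true_and, mem_filter, mem_univ]
    tauto

/-- **The averaging operator preserves the mean**: `Σ_{V ⊆ [n]} F(V) = 2^n · μ` (`t ≤ n`).
[cite: ODonnell2014, §9.5] -/
theorem sum_sliceAvg {t : ℕ} (htn : t ≤ n) (f : Finset (Fin n) → ℝ) :
    ∑ V : Finset (Fin n), sliceAvg t f V = (2 : ℝ) ^ n * sliceMean n t f := by
  have hct : ((n.choose t : ℕ) : ℝ) ≠ 0 := by
    have := Nat.choose_pos htn; positivity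
  rw [sum_univ_eq_sum_range_powersetCard]
  have hlev : ∀ s ∈ range (n + 1), ∑ V ∈ powersetCard s univ, sliceAvg t f V =
      ((n.choose s : ℕ) : ℝ) * sliceMean n t f := by
    intro s hs
    have hsn : s ≤ n := by have := mem_range.1 hs; omega
    have h0 : ∑ V ∈ powersetCard s univ, sliceAvg t f V = ∑ V ∈ powersetCard s univ, sliceAvg t f V * 1 := by
      simp
    rw [h0, sliceMean]
    rcases le_or_gt t s with hts | hst
    · rw [sum_powersetCard_sliceAvg_mul_of_le hts]
      have hin : ∀ U ∈ powersetCard t univ,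
          f U * ∑ V ∈ univ.filter (fun V : Finset (Fin n) => U ⊆ V ∧ V.card = t + (s - t)), (1 : ℝ) =
            (((n - t).choose (s - t) : ℕ) : ℝ) * f U := by
        intro U hU
        rw [sum_const, nsmul_eq_mul, mul_one, card_filter_supersets (s - t) (mem_powersetCard.1 hU).2, mul_comm]
      rw [sum_congr rfl hin, ← mul_sum, ← mul_assoc]
      have hid : ((n.choose s : ℕ) : ℝ) * ((s.choose t : ℕ) : ℝ) = (n.choose t : ℕ) * (((n - t).choose (s - t) : ℕ) : ℝ) := by
        exact_mod_cast Nat.choose_mul hts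
      have hcs : ((s.choose t : ℕ) : ℝ) ≠ 0 := by have := Nat.choose_pos hts; positivity
      rw [div_eq_mul_inv, mul_comm (∑ U ∈ powersetCard t univ, f U), ← mul_assoc]
      congr 1
      rw [inv_mul_eq_div, ← div_eq_mul_inv, div_eq_div_iff hcs hct]
      linear_combination -hid
    · rw [sum_powersetCard_sliceAvg_mul_of_lt hst]
      have hin : ∀ U ∈ powersetCard t univ, f U * ∑ V ∈ U.powersetCard s, (1 : ℝ) = ((t.choose s : ℕ) : ℝ) * f U := by
        intro U hU
        rw [sum_const, nsmul_eq_mul, mul_one, card_powersetCard, (mem_powersetCard.1 hU).2, mul_comm]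
      rw [sum_congr rfl hin, ← mul_sum, ← mul_assoc]
      have hid : ((n.choose t : ℕ) : ℝ) * ((t.choose s : ℕ) : ℝ) = (n.choose s : ℕ) * (((n - s).choose (t - s) : ℕ) : ℝ) := by
        exact_mod_cast Nat.choose_mul hst.le
      have hcs : (((n - s).choose (t - s) : ℕ) : ℝ) ≠ 0 := by
        have := Nat.choose_pos (by omega : t - s ≤ n - s); positivity
      rw [div_eq_mul_inv, mul_comm (∑ U ∈ powersetCard t univ, f U), ← mul_assoc]
      congr 1
      rw [inv_mul_eq_div, ← div_eq_mul_inv, div_eq_div_iff hcs hct]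
      linear_combination hid
  rw [sum_congr rfl hlev, ← sum_mul]
  congr 1
  exact_mod_cast Nat.sum_range_choose n

/-- The coefficient of level `s` in the transfer constant: the scalar by which "sum over the `s`-sets
next to a `t`-set" acts on `V_j`, divided by the number of `t`-sets next to an `s`-set.
[cite: ODonnell2014, §9.5] -/
def transferCoeff (n t j s : ℕ) : ℝ :=
  if t ≤ s then ff ((n : ℝ) - t - j) (s - t) / (((s - t).factorial : ℝ) * ((s.choose t : ℕ) : ℝ))
  else if j ≤ s then (((t - j).choose (s - j) : ℕ) : ℝ) / (((n - s).choose (t - s) : ℕ) : ℝ) else 0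

/-- **The transfer constant** `K = K(n,t,j) = Σ_{s ≤ n} transferCoeff n t j s`: the scalar by which
`Fᵀ ∘ (restriction to V_j)` acts, `Σ_V F(V) zeta q V = K · Σ_{|U|=t} f(U) zeta q U`.
[cite: ODonnell2014, §9.5] -/
def transferConst (n t j : ℕ) : ℝ := ∑ s ∈ range (n + 1), transferCoeff n t j s

/-- The coefficients are nonnegative when `t + j ≤ n`. [cite: ODonnell2014, §9.5] -/
theorem transferCoeff_nonneg {t j : ℕ} (htj : t + j ≤ n) (s : ℕ) : 0 ≤ transferCoeff n t j s := by
  unfold transferCoeff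
  split_ifs
  · have : ((n : ℝ) - t - j) = ((n - t - j : ℕ) : ℝ) := by
      rw [Nat.sub_sub, Nat.cast_sub htj, Nat.cast_add]; ring
    rw [this]
    exact div_nonneg (ff_natCast_nonneg _ _) (by positivity)
  · positivity
  · exact le_rfl

/-- The level-`t` coefficient is `1`. [folklore] -/
private theorem transferCoeff_self (n t j : ℕ) : transferCoeff n t j t = 1 := by
  simp [transferCoeff]

/-- `K ≥ 1 > 0` (for `t + j ≤ n`): the level-`t` coefficient alone is `1`. [cite: ODonnell2014, §9.5] -/
theorem one_le_transferConst {t j : ℕ} (htj : t + j ≤ n) : 1 ≤ transferConst n t j := by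
  unfold transferConst
  rw [← transferCoeff_self n t j]
  exact single_le_sum (fun s _ => transferCoeff_nonneg htj s) (mem_range.2 (by omega))

/-- **The averaging operator is diagonal on the eigenspaces**: for `q` harmonic of degree `j ≤ t`,
`Σ_{V ⊆ [n]} F(V) · zeta q V = K · Σ_{|U| = t} f(U) · zeta q U`.
[cite: MacWilliamsSloane1977, Ch. 21 §6 Thm. 10 (PDF p. 516)] -/
theorem sum_sliceAvg_mul_zeta {j t : ℕ} (hjt : j ≤ t) {q : Finset (Fin n) → ℝ}
    (hq : IsHarmonic j q) (f : Finset (Fin n) → ℝ) :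
    ∑ V : Finset (Fin n), sliceAvg t f V * zeta q V =
      transferConst n t j * ∑ U ∈ powersetCard t univ, f U * zeta q U := by
  rw [sum_univ_eq_sum_range_powersetCard, transferConst, sum_mul]
  refine sum_congr rfl fun s hs => ?_
  have hsn : s ≤ n := by have := mem_range.1 hs; omega
  rcases le_or_gt t s with hts | hst
  · rw [sum_powersetCard_sliceAvg_mul_of_le hts, transferCoeff, if_pos hts]
    have hin : ∀ U ∈ powersetCard t univ,
        f U * ∑ V ∈ univ.filter (fun V : Finset (Fin n) => U ⊆ V ∧ V.card = t + (s - t)), zeta q V =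
          ff ((n : ℝ) - t - j) (s - t) / (((s - t).factorial : ℕ) : ℝ) * (f U * zeta q U) := by
      intro U hU
      rw [sum_supersets_zeta hjt hq (s - t) (mem_powersetCard.1 hU).2]
      ring
    rw [sum_congr rfl hin, ← mul_sum, ← mul_assoc]
    congr 1
    ring
  · rw [sum_powersetCard_sliceAvg_mul_of_lt hst, transferCoeff, if_neg (not_le.2 hst)]
    rcases le_or_gt j s with hjs | hsj
    · rw [if_pos hjs]
      have hin : ∀ U ∈ powersetCard t univ, f U * ∑ V ∈ U.powersetCard s, zeta q V =
          (((t - j).choose (s - j) : ℕ) : ℝ) * (f U * zeta q U) := by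
        intro U hU
        rw [sum_powersetCard_zeta hjs hst.le hq.1 (mem_powersetCard.1 hU).2]
        ring
      rw [sum_congr rfl hin, ← mul_sum, ← mul_assoc]
      congr 1
      ring
    · rw [if_neg (not_le.2 hsj), zero_mul]
      have hin : ∀ U ∈ powersetCard t univ, f U * ∑ V ∈ U.powersetCard s, zeta q V = 0 := by
        intro U _
        rw [sum_powersetCard_zeta_eq_zero hsj hq.1 U, mul_zero]
      rw [sum_congr rfl hin, sum_const_zero, mul_zero]

/-! ### §4 The cube side: degree of `zeta q`, the Bonami lemma, and the power-mean step -/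

/-- The indicator of a coordinate as an affine function of the character: `𝟙[x_i] = (1 − χ_{{i}}(x))/2`.
[cite: ODonnell2014, §1.2] -/
theorem ite_eq_one_sub_walsh_div_two (x : Fin n → Bool) (i : Fin n) :
    (if x i = true then (1 : ℝ) else 0) = (1 - walsh {i} x) / 2 := by
  rw [walsh, prod_singleton]
  cases x i <;> simp [sgn]

/-- `𝟙[T ⊆ supp x] = Π_{i ∈ T} (1 − χ_{{i}}(x))/2`. [cite: ODonnell2014, §1.2] -/
theorem ite_subset_eq_prod (T : Finset (Fin n)) (x : Fin n → Bool) :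
    (if T ⊆ univ.filter (fun i => x i = true) then (1 : ℝ) else 0) = ∏ i ∈ T, (1 - walsh {i} x) / 2 := by
  rw [← prod_congr rfl (fun i _ => ite_eq_one_sub_walsh_div_two x i), prod_boole]
  congr 1
  simp [subset_iff]

/-- On the cube, a homogeneous coefficient vector of degree `j` evaluates as
`zeta q (supp x) = Σ_{|T| = j} q_T · Π_{i∈T} (1 − χ_{{i}}(x))/2`. [cite: ODonnell2014, §1.2] -/
theorem zeta_filter_eq_sum_prod {j : ℕ} {q : Finset (Fin n) → ℝ} (hq : IsHomog j q) (x : Fin n → Bool) :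
    zeta q (univ.filter (fun i => x i = true)) =
      ∑ T ∈ powersetCard j univ, q T * ∏ i ∈ T, (1 - walsh {i} x) / 2 := by
  set V := univ.filter (fun i => x i = true) with hV
  have h1 : zeta q V = ∑ T ∈ V.powersetCard j, q T := by
    rw [zeta_apply, powersetCard_eq_filter, sum_filter]
    refine sum_congr rfl fun T _ => ?_
    by_cases hT : T.card = j
    · rw [if_pos hT]
    · rw [if_neg hT, hq T hT]
  have h2 : ∑ T ∈ powersetCard j univ, q T * ∏ i ∈ T, (1 - walsh {i} x) / 2 =
      ∑ T ∈ powersetCard j univ, (if T ⊆ V then q T else 0) := by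
    refine sum_congr rfl fun T _ => ?_
    rw [← ite_subset_eq_prod, mul_ite, mul_one, mul_zero]
  rw [h1, h2, ← sum_filter]
  congr 1
  ext T
  simp only [mem_powersetCard, mem_filter, subset_univ, true_and]
  tauto

/-- **`zeta q` has Fourier level `j` on the cube** for `q` homogeneous of degree `j`: it is a
multilinear polynomial of degree `j` in the coordinates. [cite: ODonnell2014, §1.4] -/
theorem isLevelLE_zeta {j : ℕ} {q : Finset (Fin n) → ℝ} (hq : IsHomog j q) :
    IsLevelLE j (fun x : Fin n → Bool => zeta q (univ.filter (fun i => x i = true))) := by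
  have h : (fun x : Fin n → Bool => zeta q (univ.filter (fun i => x i = true))) =
      fun x => ∑ T ∈ powersetCard j univ, q T * ∏ i ∈ T, (1 - walsh {i} x) / 2 :=
    funext fun x => zeta_filter_eq_sum_prod hq x
  rw [h]
  refine Literature.Computability.Complexity.LowDegree.IsLevelLE.sum _ fun T hT => ?_
  have hone : ∀ i ∈ T, IsLevelLE 1 (fun x : Fin n → Bool => (1 - walsh {i} x) / 2) := by
    intro i _
    have h1 := ((Literature.Computability.Complexity.LowDegree.isLevelLE_const (m := n) (1 : ℝ) 1).sub
      (Literature.Computability.Complexity.LowDegree.isLevelLE_walsh {i} (by simp))).const_mul (1 / 2)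
    have he : (fun x : Fin n → Bool => 1 / 2 * (1 - walsh {i} x)) = fun x => (1 - walsh {i} x) / 2 :=
      funext fun x => by ring
    rwa [he] at h1
  have hprod := Literature.Computability.Complexity.LowDegree.IsLevelLE.prod T (d := fun _ => 1) hone
  rw [sum_const, smul_eq_mul, mul_one, (mem_powersetCard.1 hT).2] at hprod
  exact hprod.const_mul (q T)

/-- Sums over the cube `{0,1}^n` are sums over subsets of `[n]`. [folklore] -/
private theorem sum_cube_eq_sum_finset (g : Finset (Fin n) → ℝ) :
    ∑ x : Fin n → Bool, g (univ.filter (fun i => x i = true)) = ∑ V : Finset (Fin n), g V := by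
  let e : (Fin n → Bool) ≃ Finset (Fin n) :=
    { toFun := fun x => univ.filter fun i => x i = true
      invFun := fun V i => decide (i ∈ V)
      left_inv := fun x => funext fun i => by simp
      right_inv := fun V => Finset.ext fun i => by simp }
  exact Fintype.sum_equiv e _ _ (fun x => rfl)

/-- **Bonami's lemma for `zeta q`** (`q` homogeneous of degree `j`, `r ≥ 1`):
`𝔼_V[(zeta q V)^{2r}] ≤ (2r−1)^{rj} 𝔼_V[(zeta q V)²]^r` over the uniform `V ⊆ [n]`.
[cite: ODonnell2014, Thm. 9.21] -/
theorem bonami_zeta {j : ℕ} {q : Finset (Fin n) → ℝ} (hq : IsHomog j q) (r : ℕ) (hr : 1 ≤ r) :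
    (∑ V : Finset (Fin n), (zeta q V ^ 2) ^ r) / 2 ^ n ≤
      (2 * r - 1 : ℝ) ^ (r * j) * ((∑ V : Finset (Fin n), zeta q V ^ 2) / 2 ^ n) ^ r := by
  have h := (isLevelLE_zeta hq).bonami_even_moment r hr
  rw [sum_cube_eq_sum_finset (fun V => (zeta q V ^ 2) ^ r), sum_cube_eq_sum_finset (fun V => zeta q V ^ 2)] at h
  exact h

/-- **The power-mean (Hölder) step** of the level-`k` inequality: for `0 ≤ F ≤ 1` on `s` with
`Σ F = N α` and any `G`, `((Σ F G)/N)^{2r} ≤ α^{2r−1} · (Σ (G²)^r)/N`.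
[cite: ODonnell2014, §9.5] -/
theorem pow_avg_mul_le {ι : Type*} (s : Finset ι) (F G : ι → ℝ) (hF0 : ∀ i ∈ s, 0 ≤ F i)
    (hF1 : ∀ i ∈ s, F i ≤ 1) {N α : ℝ} (hN : 0 < N) (hα : ∑ i ∈ s, F i = N * α) (r : ℕ) (hr : 1 ≤ r) :
    ((∑ i ∈ s, F i * G i) / N) ^ (2 * r) ≤ α ^ (2 * r - 1) * ((∑ i ∈ s, (G i ^ 2) ^ r) / N) := by
  have hα0 : 0 ≤ α := by
    have h : 0 ≤ N * α := hα ▸ sum_nonneg hF0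
    exact (mul_nonneg_iff_of_pos_left hN).mp h
  have hr0 : r ≠ 0 := by omega
  -- reduce to `|G|`
  have habs : ((∑ i ∈ s, F i * G i) / N) ^ (2 * r) ≤ ((∑ i ∈ s, F i * |G i|) / N) ^ (2 * r) := by
    rw [← (even_two_mul r).pow_abs, abs_div, abs_of_pos hN]
    refine pow_le_pow_left₀ (by positivity) (div_le_div_of_nonneg_right ?_ hN.le) _
    exact (abs_sum_le_sum_abs _ _).trans (le_of_eq (sum_congr rfl fun i hi => by
      rw [abs_mul, abs_of_nonneg (hF0 i hi)]))
  refine habs.trans ?_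
  rcases hα0.eq_or_lt with hαz | hαpos
  · -- `α = 0`: `F = 0`
    have hF : ∀ i ∈ s, F i = 0 := by
      have hs : ∑ i ∈ s, F i = 0 := by rw [hα, ← hαz, mul_zero]
      exact (sum_eq_zero_iff_of_nonneg hF0).1 hs
    have h0 : ∑ i ∈ s, F i * |G i| = 0 := sum_eq_zero fun i hi => by rw [hF i hi, zero_mul]
    rw [h0, zero_div, zero_pow (by omega), ← hαz, zero_pow (by omega), zero_mul]
  -- weights `w i = F i / (N α)`
  set w : ι → ℝ := fun i => F i / (N * α) with hw_def
  have hw0 : ∀ i ∈ s, 0 ≤ w i := fun i hi => div_nonneg (hF0 i hi) (by positivity)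
  have hw1 : ∑ i ∈ s, w i = 1 := by
    rw [hw_def]; simp only; rw [← sum_div, hα, div_self (by positivity)]
  have hpm := Real.pow_arith_mean_le_arith_mean_pow s w (fun i => |G i|) hw0 hw1
    (fun i _ => abs_nonneg _) (2 * r)
  have e1 : ∑ i ∈ s, w i * |G i| = ((∑ i ∈ s, F i * |G i|) / N) / α := by
    simp only [hw_def]
    rw [div_div, sum_div]
    exact sum_congr rfl fun i _ => by ring
  have e2 : ∑ i ∈ s, w i * |G i| ^ (2 * r) ≤ ((∑ i ∈ s, (G i ^ 2) ^ r) / N) / α := by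
    simp only [hw_def]
    rw [div_div, sum_div]
    refine sum_le_sum fun i hi => ?_
    rw [pow_mul, sq_abs, div_mul_eq_mul_div]
    refine div_le_div_of_nonneg_right ?_ (by positivity)
    exact mul_le_of_le_one_left (by positivity) (hF1 i hi)
  rw [e1] at hpm
  have h := hpm.trans e2
  rw [div_pow, div_le_div_iff₀ (pow_pos hαpos _) hαpos] at h
  calc ((∑ i ∈ s, F i * |G i|) / N) ^ (2 * r)
      = ((∑ i ∈ s, F i * |G i|) / N) ^ (2 * r) * α / α := by rw [mul_div_cancel_right₀ _ hαpos.ne']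
    _ ≤ ((∑ i ∈ s, (G i ^ 2) ^ r) / N) * α ^ (2 * r) / α := div_le_div_of_nonneg_right h hαpos.le
    _ = α ^ (2 * r - 1) * ((∑ i ∈ s, (G i ^ 2) ^ r) / N) := by
        obtain ⟨u, hu⟩ : ∃ u, 2 * r = u + 1 := ⟨2 * r - 1, by omega⟩
        rw [hu, Nat.add_sub_cancel, pow_succ]
        field_simp

/-! ### §5 The level-`j` inequality on the slice -/

/-- **The transfer factor** `Λ(n,t,j) = 4^{n−j} (t−j)! / (K² · ff(n−2j, t−j))`: the constant in the
slice level-`j` inequality produced by the transfer. [cite: ODonnell2014, §9.5] -/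
def transferLambda (n t j : ℕ) : ℝ :=
  (4 : ℝ) ^ (n - j) * ((t - j).factorial : ℝ) / (transferConst n t j ^ 2 * ff ((n : ℝ) - 2 * j) (t - j))

/-- `ff(n−2j, t−j) > 0` for `j ≤ t`, `t + j ≤ n`. [cite: Grigoriev2001, §1 (B_k = r(r−1)⋯(r−k+1)/(n(n−1)⋯(n−k+1)), PDF p. 8)] -/
theorem ff_sub_pos {j t : ℕ} (hjt : j ≤ t) (htj : t + j ≤ n) : 0 < ff ((n : ℝ) - 2 * j) (t - j) := by
  refine ff_pos ?_
  have h1 : ((t - j : ℕ) : ℝ) = (t : ℝ) - j := by rw [Nat.cast_sub hjt]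
  have h2 : (t : ℝ) + j ≤ n := by exact_mod_cast htj
  rw [h1]; linarith

/-- `Λ > 0`. [cite: ODonnell2014, §9.5] -/
theorem transferLambda_pos {j t : ℕ} (hjt : j ≤ t) (htj : t + j ≤ n) : 0 < transferLambda n t j := by
  unfold transferLambda
  have hK : 0 < transferConst n t j := lt_of_lt_of_le zero_lt_one (one_le_transferConst htj)
  have hff := ff_sub_pos hjt htj
  positivity

/-- **The level-`j` inequality on the slice, moment form.** For `0 ≤ f ≤ 1` on the `t`-subsets of `[n]`
with mean `μ`, every harmonic `q` of degree `j ≤ t` with `t + j ≤ n`, and every `r ≥ 1`: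
`(Σ_{|U|=t} f(U) zeta q U)^{2r} ≤ μ^{2r−1} · (2r−1)^{rj} · (Λ · Σ_{|U|=t} (zeta q U)²)^r`
— O'Donnell's level-`k` inequality (Hölder route, `W_k[f]^r ≤ α^{2r−1}(2r−1)^{rk}`) transplanted to the
slice with the transfer factor `Λ = transferLambda n t j`. [cite: ODonnell2014, §9.5] -/
theorem slice_level_pow_le {j t : ℕ} (hjt : j ≤ t) (htj : t + j ≤ n) {q : Finset (Fin n) → ℝ}
    (hq : IsHarmonic j q) (f : Finset (Fin n) → ℝ) (hf0 : ∀ U : Finset (Fin n), U.card = t → 0 ≤ f U)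
    (hf1 : ∀ U : Finset (Fin n), U.card = t → f U ≤ 1) (r : ℕ) (hr : 1 ≤ r) :
    (∑ U ∈ powersetCard t univ, f U * zeta q U) ^ (2 * r) ≤
      sliceMean n t f ^ (2 * r - 1) * (2 * r - 1 : ℝ) ^ (r * j) *
        (transferLambda n t j * ∑ U ∈ powersetCard t univ, zeta q U ^ 2) ^ r := by
  have htn : t ≤ n := by omega
  have h2j : 2 * j ≤ n := by omega
  set K := transferConst n t j with hK_def
  set S := ∑ U ∈ powersetCard t univ, f U * zeta q U with hS_def
  set N := ∑ U ∈ powersetCard t univ, zeta q U ^ 2 with hN_def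
  set μ := sliceMean n t f with hμ_def
  have hK : 0 < K := lt_of_lt_of_le zero_lt_one (one_le_transferConst htj)
  have hff := ff_sub_pos hjt htj
  have h2n : (0 : ℝ) < 2 ^ n := by positivity
  have hμ0 : 0 ≤ μ := by
    rw [hμ_def, sliceMean]
    exact div_nonneg (sum_nonneg fun U hU => hf0 U (mem_powersetCard.1 hU).2) (Nat.cast_nonneg _)
  have h2r0 : (0 : ℝ) ≤ 2 * r - 1 := by
    have : (1 : ℝ) ≤ r := by exact_mod_cast hr
    linarith
  -- (1) the averaging operator: mean and correlation with `zeta q`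
  have h1 : ∑ V : Finset (Fin n), sliceAvg t f V * zeta q V = K * S := sum_sliceAvg_mul_zeta hjt hq f
  have h2 : ∑ V : Finset (Fin n), sliceAvg t f V = 2 ^ n * μ := sum_sliceAvg htn f
  -- (2) power means and Bonami on the cube
  have h3 := pow_avg_mul_le (univ : Finset (Finset (Fin n))) (sliceAvg t f) (zeta q)
    (fun V _ => sliceAvg_nonneg hf0 V) (fun V _ => sliceAvg_le_one hf1 V) h2n h2 r hr
  have h4 := bonami_zeta hq.1 r hr
  rw [sum_univ_zeta_sq h2j hq] at h4
  rw [h1] at h3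
  have h5 : (K * S / 2 ^ n) ^ (2 * r) ≤
      μ ^ (2 * r - 1) * ((2 * r - 1 : ℝ) ^ (r * j) * ((2 : ℝ) ^ (n - 2 * j) * ip q q / 2 ^ n) ^ r) :=
    h3.trans (mul_le_mul_of_nonneg_left h4 (pow_nonneg hμ0 _))
  -- (3) bookkeeping: `2^{n−2j}/2^n · (2^n)² = 4^{n−j}`, `ip q q = (t−j)!/ff · N`, `4^{n−j}(t−j)!/ff = Λ K²`
  have hip : ip q q = ((t - j).factorial : ℝ) / ff ((n : ℝ) - 2 * j) (t - j) * N := by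
    rw [hN_def, sum_powersetCard_zeta_sq hjt hq]
    field_simp
  have e4 : (2 : ℝ) ^ n * (2 : ℝ) ^ (n - 2 * j) = (4 : ℝ) ^ (n - j) := by
    rw [← pow_add, show n + (n - 2 * j) = 2 * (n - j) by omega, pow_mul]; norm_num
  have hΛ : (4 : ℝ) ^ (n - j) * ip q q = K ^ 2 * (transferLambda n t j * N) := by
    rw [hip, transferLambda, ← hK_def]
    field_simp
  have e5 : (K * S / 2 ^ n) ^ (2 * r) * ((2 : ℝ) ^ n) ^ (2 * r) = K ^ (2 * r) * S ^ (2 * r) := by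
    rw [div_pow, div_mul_cancel₀ _ (by positivity), mul_pow]
  have e6 : ((2 : ℝ) ^ (n - 2 * j) * ip q q / 2 ^ n) ^ r * ((2 : ℝ) ^ n) ^ (2 * r) =
      K ^ (2 * r) * (transferLambda n t j * N) ^ r := by
    have hsq : ((2 : ℝ) ^ n) ^ (2 * r) = ((2 : ℝ) ^ n * 2 ^ n) ^ r := by rw [pow_mul, sq]
    have hin : (2 : ℝ) ^ (n - 2 * j) * ip q q / 2 ^ n * (2 ^ n * 2 ^ n) = (4 : ℝ) ^ (n - j) * ip q q := by
      rw [← e4]; field_simp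
    rw [hsq, ← mul_pow, hin, hΛ, mul_pow, ← pow_mul]
  have h6 : K ^ (2 * r) * S ^ (2 * r) ≤
      K ^ (2 * r) * (μ ^ (2 * r - 1) * (2 * r - 1 : ℝ) ^ (r * j) * (transferLambda n t j * N) ^ r) := by
    have := mul_le_mul_of_nonneg_right h5 (le_of_lt (pow_pos h2n (2 * r)))
    rw [e5] at this
    refine this.trans (le_of_eq ?_)
    rw [mul_assoc, mul_assoc, e6]
    ring
  exact le_of_mul_le_mul_left h6 (pow_pos hK _)

/-- The mean of a nonnegative function on the `t`-slice is nonnegative. [cite: ODonnell2014, §9.5] -/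
theorem sliceMean_nonneg {t : ℕ} {f : Finset (Fin n) → ℝ} (hf0 : ∀ U : Finset (Fin n), U.card = t → 0 ≤ f U) :
    0 ≤ sliceMean n t f :=
  div_nonneg (sum_nonneg fun U hU => hf0 U (mem_powersetCard.1 hU).2) (Nat.cast_nonneg _)

/-- The mean of a function `≤ 1` on the `t`-slice is `≤ 1`. [cite: ODonnell2014, §9.5] -/
theorem sliceMean_le_one {t : ℕ} {f : Finset (Fin n) → ℝ} (hf1 : ∀ U : Finset (Fin n), U.card = t → f U ≤ 1) :
    sliceMean n t f ≤ 1 := by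
  unfold sliceMean
  rcases Nat.eq_zero_or_pos (n.choose t) with h | h
  · rw [h, Nat.cast_zero, div_zero]; exact zero_le_one
  · rw [div_le_one (by exact_mod_cast h)]
    calc ∑ U ∈ powersetCard t univ, f U ≤ ∑ U ∈ powersetCard t univ, (1 : ℝ) :=
          sum_le_sum fun U hU => hf1 U (mem_powersetCard.1 hU).2
      _ = ((n.choose t : ℕ) : ℝ) := by simp [card_univ, Fintype.card_fin]

/-- A `[0,1]`-valued function of mean zero on the `t`-slice (`t ≤ n`) vanishes there, and so do its
correlations. [cite: ODonnell2014, §9.5] -/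
theorem sum_mul_eq_zero_of_sliceMean_eq_zero {t : ℕ} (htn : t ≤ n) {f : Finset (Fin n) → ℝ}
    (hf0 : ∀ U : Finset (Fin n), U.card = t → 0 ≤ f U) (hμ : sliceMean n t f = 0)
    (g : Finset (Fin n) → ℝ) : ∑ U ∈ powersetCard t univ, f U * g U = 0 := by
  have hct : ((n.choose t : ℕ) : ℝ) ≠ 0 := by have := Nat.choose_pos htn; positivity
  rw [sliceMean, div_eq_zero_iff, or_iff_left hct,
    sum_eq_zero_iff_of_nonneg (fun U hU => hf0 U (mem_powersetCard.1 hU).2)] at hμ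
  exact sum_eq_zero fun U hU => by rw [hμ U hU, zero_mul]

/-- **The level-`j` inequality on the slice, real-exponent form**: for every `r ≥ 1`,
`⟨f, zeta q⟩² ≤ μ^{2 − 1/r} · (2r−1)^j · Λ · Σ_{|U|=t} (zeta q U)²`; dividing by `C(n,t) · Σ (zeta q)²`
this reads `W_j[f] ≤ (Λ / C(n,t)) · μ^{2−1/r} (2r−1)^j`. [cite: ODonnell2014, §9.5] -/
theorem slice_level_sq_le {j t : ℕ} (hjt : j ≤ t) (htj : t + j ≤ n) {q : Finset (Fin n) → ℝ}
    (hq : IsHarmonic j q) (f : Finset (Fin n) → ℝ) (hf0 : ∀ U : Finset (Fin n), U.card = t → 0 ≤ f U)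
    (hf1 : ∀ U : Finset (Fin n), U.card = t → f U ≤ 1) (r : ℕ) (hr : 1 ≤ r) :
    (∑ U ∈ powersetCard t univ, f U * zeta q U) ^ 2 ≤
      sliceMean n t f ^ ((2 : ℝ) - 1 / r) * (2 * r - 1 : ℝ) ^ j *
        (transferLambda n t j * ∑ U ∈ powersetCard t univ, zeta q U ^ 2) := by
  have h := slice_level_pow_le hjt htj hq f hf0 hf1 r hr
  set μ := sliceMean n t f with hμ_def
  have hμ0 : 0 ≤ μ := sliceMean_nonneg hf0
  have h2r0 : (0 : ℝ) ≤ 2 * r - 1 := by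
    have : (1 : ℝ) ≤ r := by exact_mod_cast hr
    linarith
  have hΛN : 0 ≤ transferLambda n t j * ∑ U ∈ powersetCard t univ, zeta q U ^ 2 :=
    mul_nonneg (transferLambda_pos hjt htj).le (sum_nonneg fun U _ => sq_nonneg _)
  have hr0 : r ≠ 0 := by omega
  have hrpos : (0 : ℝ) < r := by exact_mod_cast (Nat.pos_of_ne_zero hr0)
  -- `(μ^{2 − 1/r})^r = μ^{2r−1}`
  have hμpow : (μ ^ ((2 : ℝ) - 1 / r)) ^ r = μ ^ (2 * r - 1) := by
    rw [← Real.rpow_natCast, ← Real.rpow_mul hμ0]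
    have hexp : ((2 : ℝ) - 1 / r) * r = ((2 * r - 1 : ℕ) : ℝ) := by
      rw [Nat.cast_sub (by omega), Nat.cast_mul, Nat.cast_two, Nat.cast_one]
      field_simp
    rw [hexp, Real.rpow_natCast]
  refine (pow_le_pow_iff_left₀ (sq_nonneg _) (by positivity) hr0).mp ?_
  rw [← pow_mul, mul_pow, mul_pow, ← pow_mul, mul_comm j r, hμpow]
  exact h

/-- **The level-`j` inequality on the slice, logarithmic form** (`j ≥ 1`): with `ℓ = ln(1/μ)`,
`⟨f, zeta q⟩² ≤ Λ · μ² · (e (2ℓ/j + 3))^j · Σ_{|U|=t} (zeta q U)²`, i.e.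
`W_j[f] ≤ (Λ/C(n,t)) · μ² · (e (2 ln(1/μ)/j + 3))^j` — the shape `μ² (C ln(1/μ)/j)^j` of O'Donnell's
level-`k` inequality, up to the transfer factor (`r = ⌈ℓ/j⌉ + 1` in `slice_level_sq_le`).
[cite: ODonnell2014, §9.5] -/
theorem slice_level_sq_le_log {j t : ℕ} (hj : 1 ≤ j) (hjt : j ≤ t) (htj : t + j ≤ n)
    {q : Finset (Fin n) → ℝ} (hq : IsHarmonic j q) (f : Finset (Fin n) → ℝ)
    (hf0 : ∀ U : Finset (Fin n), U.card = t → 0 ≤ f U) (hf1 : ∀ U : Finset (Fin n), U.card = t → f U ≤ 1) :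
    (∑ U ∈ powersetCard t univ, f U * zeta q U) ^ 2 ≤
      transferLambda n t j * sliceMean n t f ^ 2 *
        (Real.exp 1 * (2 * Real.log (1 / sliceMean n t f) / j + 3)) ^ j *
        ∑ U ∈ powersetCard t univ, zeta q U ^ 2 := by
  set μ := sliceMean n t f with hμ_def
  set N := ∑ U ∈ powersetCard t univ, zeta q U ^ 2 with hN_def
  have htn : t ≤ n := by omega
  have hμ0 : 0 ≤ μ := sliceMean_nonneg hf0
  have hμ1 : μ ≤ 1 := sliceMean_le_one hf1
  have hΛ := transferLambda_pos hjt htj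
  have hN0 : 0 ≤ N := sum_nonneg fun U _ => sq_nonneg _
  have hjpos : (0 : ℝ) < j := by exact_mod_cast hj
  rcases hμ0.eq_or_lt with hμz | hμpos
  · rw [sum_mul_eq_zero_of_sliceMean_eq_zero htn hf0 hμz.symm, ← hμz]
    simp
  set L := Real.log (1 / μ) with hL_def
  have hL0 : 0 ≤ L := Real.log_nonneg (by rw [le_div_iff₀ hμpos, one_mul]; exact hμ1)
  set r : ℕ := ⌈L / j⌉₊ + 1 with hr_def
  have hr : 1 ≤ r := by omega
  have h := slice_level_sq_le hjt htj hq f hf0 hf1 r hr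
  -- `μ^{2 − 1/r} ≤ μ² e^j`
  have hrpos : (0 : ℝ) < r := by exact_mod_cast (by omega : 0 < r)
  have h1 : μ ^ ((2 : ℝ) - 1 / r) ≤ μ ^ 2 * Real.exp 1 ^ j := by
    rw [sub_eq_add_neg, Real.rpow_add hμpos, Real.rpow_two, Real.exp_one_pow]
    refine mul_le_mul_of_nonneg_left ?_ (sq_nonneg _)
    rw [Real.rpow_def_of_pos hμpos, Real.exp_le_exp]
    have hlog : Real.log μ = -L := by rw [hL_def, one_div, Real.log_inv, neg_neg]
    rw [hlog, show -L * -(1 / (r : ℝ)) = L / r by ring, div_le_iff₀ hrpos]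
    have hceil : L / j ≤ ⌈L / j⌉₊ := Nat.le_ceil _
    have hrj : (⌈L / j⌉₊ : ℝ) + 1 = r := by rw [hr_def]; push_cast; ring
    rw [div_le_iff₀ hjpos] at hceil
    nlinarith
  -- `2r − 1 ≤ 2L/j + 3`
  have h2 : (2 * r - 1 : ℝ) ≤ 2 * L / j + 3 := by
    have hceil : (⌈L / j⌉₊ : ℝ) < L / j + 1 := Nat.ceil_lt_add_one (div_nonneg hL0 hjpos.le)
    have hrj : (r : ℝ) = ⌈L / j⌉₊ + 1 := by rw [hr_def]; push_cast; ring
    rw [hrj]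
    have : 2 * L / j = 2 * (L / j) := by ring
    linarith
  have h2r0 : (0 : ℝ) ≤ 2 * r - 1 := by
    have : (1 : ℝ) ≤ r := by exact_mod_cast hr
    linarith
  have h3 : (2 * r - 1 : ℝ) ^ j ≤ (2 * L / j + 3) ^ j := pow_le_pow_left₀ h2r0 h2 j
  calc (∑ U ∈ powersetCard t univ, f U * zeta q U) ^ 2
      ≤ μ ^ ((2 : ℝ) - 1 / r) * (2 * r - 1 : ℝ) ^ j * (transferLambda n t j * N) := h
    _ ≤ (μ ^ 2 * Real.exp 1 ^ j) * (2 * L / j + 3) ^ j * (transferLambda n t j * N) := by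
        gcongr
    _ = transferLambda n t j * μ ^ 2 * (Real.exp 1 * (2 * L / j + 3)) ^ j * N := by
        rw [mul_pow]; ring

/-! ### §6 Absolute constants on balanced slices

On balanced slices (`n ≤ 4t`, `2t ≤ n`) and for `8j ≤ n`, `n ≥ 64`, the transfer factor satisfies
`Λ ≤ 16 · 48^j · C(n,t)`: the transfer constant is at least `3^{−j} 2^n/(4 C(n,t))` (levels
`n/2 ≤ s ≤ 5n/8` alone, whose binomial mass is `≥ 2^n/4` by Chebyshev's inequality), and
`C(n,t) ≤ (64/3)^j C(n−2j, t−j)`. -/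

/-- A `±1`-valued bit as an affine function of its indicator: `sgn b = 1 − 2·𝟙[b]`. [cite: ODonnell2014, §1.2] -/
private theorem sgn_eq_one_sub (b : Bool) : sgn b = 1 - 2 * (if b = true then (1 : ℝ) else 0) := by
  cases b <;> norm_num [sgn]

/-- **The variance of the binomial distribution**: `Σ_s C(n,s) (n − 2s)² = n · 2^n`
(as `𝔼_x (Σ_i χ_{{i}}(x))² = n` on the cube, by orthogonality of characters). [cite: ODonnell2014, §1.4] -/
theorem sum_choose_mul_sq (n : ℕ) :
    ∑ s ∈ range (n + 1), ((n.choose s : ℕ) : ℝ) * ((n : ℝ) - 2 * s) ^ 2 = (n : ℝ) * 2 ^ n := by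
  -- `Σ_x (Σ_i sgn x_i)² = n 2^n`
  have h1 : ∑ x : Fin n → Bool, (∑ i, sgn (x i)) ^ 2 = (n : ℝ) * 2 ^ n := by
    have hx : ∀ x : Fin n → Bool, (∑ i, sgn (x i)) ^ 2 = ∑ i, ∑ k, walsh {i} x * walsh {k} x := by
      intro x
      rw [sq, sum_mul_sum]
      refine sum_congr rfl fun i _ => sum_congr rfl fun k _ => ?_
      simp [walsh]
    simp_rw [hx]
    rw [sum_comm]
    have hik : ∀ i : Fin n, ∑ x : Fin n → Bool, ∑ k, walsh {i} x * walsh {k} x = 2 ^ n := by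
      intro i
      rw [sum_comm]
      simp_rw [Literature.Computability.Complexity.LowDegree.sum_walsh_mul_walsh_index]
      simp [Finset.singleton_inj]
    simp_rw [hik]
    simp
  -- `Σ_i sgn x_i = n − 2 |supp x|`
  have h2 : ∀ x : Fin n → Bool, ∑ i, sgn (x i) = (n : ℝ) - 2 * ((univ.filter fun i => x i = true).card : ℝ) := by
    intro x
    simp_rw [sgn_eq_one_sub]
    rw [sum_sub_distrib, ← mul_sum, sum_boole]
    simp
  simp_rw [h2] at h1
  rw [sum_cube_eq_sum_finset (fun V => ((n : ℝ) - 2 * (V.card : ℝ)) ^ 2), ← powerset_univ,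
    Finset.sum_powerset_apply_card (fun m => ((n : ℝ) - 2 * (m : ℝ)) ^ 2), card_univ, Fintype.card_fin] at h1
  rw [← h1]
  exact sum_congr rfl fun s _ => by rw [nsmul_eq_mul]

/-- At least half of the binomial mass sits on the levels `s ≥ n/2`:
`2^n ≤ 2 Σ_{n ≤ 2s} C(n,s)`. [cite: ODonnell2014, §1.4] -/
theorem two_pow_le_two_mul_sum_choose_upper (n : ℕ) :
    (2 : ℝ) ^ n ≤ 2 * ∑ s ∈ range (n + 1), (if n ≤ 2 * s then ((n.choose s : ℕ) : ℝ) else 0) := by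
  have htot : ∑ s ∈ range (n + 1), ((n.choose s : ℕ) : ℝ) = 2 ^ n := by exact_mod_cast Nat.sum_range_choose n
  have hsplit : ∑ s ∈ range (n + 1), ((n.choose s : ℕ) : ℝ) =
      ∑ s ∈ range (n + 1), (if 2 * s < n then ((n.choose s : ℕ) : ℝ) else 0) +
        ∑ s ∈ range (n + 1), (if n ≤ 2 * s then ((n.choose s : ℕ) : ℝ) else 0) := by
    rw [← sum_add_distrib]
    refine sum_congr rfl fun s _ => ?_
    by_cases h : 2 * s < n
    · rw [if_pos h, if_neg (not_le.2 h), add_zero]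
    · rw [if_neg h, if_pos (not_lt.1 h), zero_add]
  -- reflect the lower half: `s ↦ n − s`
  have hlow : ∑ s ∈ range (n + 1), (if 2 * s < n then ((n.choose s : ℕ) : ℝ) else 0) ≤
      ∑ s ∈ range (n + 1), (if n ≤ 2 * s then ((n.choose s : ℕ) : ℝ) else 0) := by
    rw [← sum_flip (fun s => if 2 * s < n then ((n.choose s : ℕ) : ℝ) else 0)]
    refine sum_le_sum fun s hs => ?_
    have hsn : s ≤ n := by have := mem_range.1 hs; omega
    show (if 2 * (n - s) < n then ((n.choose (n - s) : ℕ) : ℝ) else 0) ≤ _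
    rw [Nat.choose_symm hsn]
    by_cases h : 2 * (n - s) < n
    · rw [if_pos h, if_pos (by omega)]
    · rw [if_neg h]; split_ifs <;> positivity
  linarith

/-- The binomial tail beyond `5n/8` is small: `n² Σ_{8s > 5n} C(n,s) ≤ 16 n 2^n` (Chebyshev).
[cite: ODonnell2014, §1.4] -/
theorem sq_mul_sum_choose_tail_le (n : ℕ) :
    (n : ℝ) ^ 2 * ∑ s ∈ range (n + 1), (if 5 * n < 8 * s then ((n.choose s : ℕ) : ℝ) else 0) ≤ 16 * ((n : ℝ) * 2 ^ n) := by
  rw [← sum_choose_mul_sq n, mul_sum, mul_sum]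
  refine sum_le_sum fun s _ => ?_
  split_ifs with h
  · have h' : (5 : ℝ) * n < 8 * s := by exact_mod_cast h
    have hsq : (n : ℝ) ^ 2 ≤ 16 * ((n : ℝ) - 2 * s) ^ 2 := by nlinarith
    calc (n : ℝ) ^ 2 * ((n.choose s : ℕ) : ℝ) ≤ 16 * ((n : ℝ) - 2 * s) ^ 2 * ((n.choose s : ℕ) : ℝ) :=
          mul_le_mul_of_nonneg_right hsq (Nat.cast_nonneg _)
      _ = 16 * (((n.choose s : ℕ) : ℝ) * ((n : ℝ) - 2 * s) ^ 2) := by ring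
  · rw [mul_zero]; positivity

/-- **The binomial window** `n/2 ≤ s ≤ 5n/8` carries a quarter of the mass for `n ≥ 64`:
`2^n ≤ 4 Σ_{n ≤ 2s, 8s ≤ 5n} C(n,s)`. [cite: ODonnell2014, §1.4] -/
theorem two_pow_le_four_mul_sum_choose_window {n : ℕ} (hn : 64 ≤ n) :
    (2 : ℝ) ^ n ≤ 4 * ∑ s ∈ range (n + 1),
      (if n ≤ 2 * s ∧ 8 * s ≤ 5 * n then ((n.choose s : ℕ) : ℝ) else 0) := by
  have hup := two_pow_le_two_mul_sum_choose_upper n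
  have htail := sq_mul_sum_choose_tail_le n
  have hn0 : (64 : ℝ) ≤ n := by exact_mod_cast hn
  -- window = upper half minus the tail
  have hsplit : ∑ s ∈ range (n + 1), (if n ≤ 2 * s then ((n.choose s : ℕ) : ℝ) else 0) ≤
      ∑ s ∈ range (n + 1), (if n ≤ 2 * s ∧ 8 * s ≤ 5 * n then ((n.choose s : ℕ) : ℝ) else 0) +
        ∑ s ∈ range (n + 1), (if 5 * n < 8 * s then ((n.choose s : ℕ) : ℝ) else 0) := by
    rw [← sum_add_distrib]
    refine sum_le_sum fun s _ => ?_
    by_cases h1 : n ≤ 2 * s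
    · by_cases h2 : 8 * s ≤ 5 * n
      · rw [if_pos h1, if_pos ⟨h1, h2⟩, if_neg (not_lt.2 h2), add_zero]
      · rw [if_pos h1, if_neg (fun h => h2 h.2), if_pos (not_le.1 h2), zero_add]
    · rw [if_neg h1]; split_ifs <;> positivity
  -- the tail is at most `2^n/4` for `n ≥ 64`
  have htail' : ∑ s ∈ range (n + 1), (if 5 * n < 8 * s then ((n.choose s : ℕ) : ℝ) else 0) ≤ 2 ^ n / 4 := by
    have hn2 : (0 : ℝ) < (n : ℝ) ^ 2 := by positivity
    rw [le_div_iff₀ (by norm_num : (0 : ℝ) < 4)]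
    have h64 : 64 * (n : ℝ) ≤ (n : ℝ) ^ 2 := by nlinarith
    nlinarith [sum_nonneg (fun s (_ : s ∈ range (n + 1)) =>
      (show (0 : ℝ) ≤ (if 5 * n < 8 * s then ((n.choose s : ℕ) : ℝ) else 0) by split_ifs <;> positivity)),
      pow_pos (show (0:ℝ) < 2 by norm_num) n]
  linarith

/-- `C(2a, j) ≤ 3^j C(a, j)` for `2j ≤ a`. [cite: ODonnell2014, §1.4] -/
theorem choose_two_mul_le_three_pow_mul_choose {a : ℕ} : ∀ {j : ℕ}, 2 * j ≤ a →
    (2 * a).choose j ≤ 3 ^ j * a.choose j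
  | 0, _ => by simp
  | j + 1, hj => by
    have ih : (2 * a).choose j ≤ 3 ^ j * a.choose j := choose_two_mul_le_three_pow_mul_choose (by omega)
    have h1 := Nat.choose_succ_right_eq (2 * a) j
    have h2 := Nat.choose_succ_right_eq a j
    have h4 : 2 * a - j ≤ 3 * (a - j) := by omega
    -- `C(2a, j+1)(j+1) = C(2a,j)(2a−j) ≤ 3^j C(a,j) · 3(a−j) = 3^{j+1} C(a,j+1)(j+1)`
    have h3 : (2 * a).choose (j + 1) * (j + 1) ≤ 3 ^ (j + 1) * a.choose (j + 1) * (j + 1) := by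
      rw [h1, mul_assoc (3 ^ (j + 1)), h2, pow_succ]
      calc (2 * a).choose j * (2 * a - j) ≤ 3 ^ j * a.choose j * (2 * a - j) :=
            Nat.mul_le_mul_right (2 * a - j) ih
        _ ≤ 3 ^ j * a.choose j * (3 * (a - j)) := Nat.mul_le_mul_left (3 ^ j * a.choose j) h4
        _ = 3 ^ j * 3 * (a.choose j * (a - j)) := by ring
    exact Nat.le_of_mul_le_mul_right h3 (Nat.succ_pos j)

/-- **Each window level contributes**: for `t ≤ s ≤ n` with `8s ≤ 5n`, `n ≤ 4t` and `8j ≤ n`,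
`C(n, s) ≤ 3^j · C(n,t) · transferCoeff n t j s` (`transferCoeff n t j s = C(n−t−j, s−t)/C(s,t)`).
[cite: ODonnell2014, §9.5] -/
theorem choose_le_transferCoeff_mul {t j s : ℕ} (hts : t ≤ s) (hsn : s ≤ n) (hs : 8 * s ≤ 5 * n)
    (hbal : n ≤ 4 * t) (hj : 8 * j ≤ n) :
    ((n.choose s : ℕ) : ℝ) ≤ 3 ^ j * ((n.choose t : ℕ) : ℝ) * transferCoeff n t j s := by
  have htj : t + j ≤ n := by omega
  -- `transferCoeff = C(n−t−j, s−t) / C(s,t)`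
  have hco : transferCoeff n t j s = (((n - t - j).choose (s - t) : ℕ) : ℝ) / ((s.choose t : ℕ) : ℝ) := by
    rw [transferCoeff, if_pos hts, show ((n : ℝ) - t - j) = ((n - t - j : ℕ) : ℝ) by
      rw [Nat.sub_sub, Nat.cast_sub htj, Nat.cast_add]; ring, ← ff_natCast_div_factorial (n - t - j) (s - t)]
    rw [div_div]
  have hcs : (0 : ℝ) < ((s.choose t : ℕ) : ℝ) := by exact_mod_cast Nat.choose_pos hts
  rw [hco, mul_div_assoc', le_div_iff₀ hcs]
  -- integer inequality: `C(n,s) C(s,t) = C(n,t) C(n−t,s−t) ≤ 3^j C(n,t) C(n−t−j, s−t)`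
  have key : n.choose s * s.choose t ≤ 3 ^ j * n.choose t * (n - t - j).choose (s - t) := by
    rw [Nat.choose_mul hts]
    -- multiply by `C(n−t, j) > 0` and use `C(n−t,s−t) C(n−s, j) = C(n−t, j) C(n−t−j, s−t)`
    have hpos : 0 < (n - t).choose j := Nat.choose_pos (by omega)
    refine Nat.le_of_mul_le_mul_right ?_ hpos
    -- `C(A, B) C(A − B, j) = C(A, j) C(A − j, B)` with `A = n − t`, `B = s − t` (both count pairs of
    -- disjoint subsets; the tree's `Literature.GroupTheory.PermutationGroups.choose_mul_choose_sub`,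
    -- re-derived inline from `Nat.choose_mul` to keep the imports of this file combinatorial)
    have hid : (n - t).choose (s - t) * (n - s).choose j = (n - t).choose j * (n - t - j).choose (s - t) := by
      have e1 := Nat.choose_mul (n := n - t) (k := (s - t) + j) (s := s - t) (Nat.le_add_right _ j)
      have e2 := Nat.choose_mul (n := n - t) (k := (s - t) + j) (s := j) (Nat.le_add_left j _)
      rw [Nat.add_sub_cancel_left, Nat.choose_symm_add, show n - t - (s - t) = n - s by omega] at e1
      rw [Nat.add_sub_cancel] at e2
      rw [← e1, ← e2]
    have h3 : (n - t).choose j ≤ 3 ^ j * (n - s).choose j :=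
      calc (n - t).choose j ≤ (2 * (n - s)).choose j := Nat.choose_le_choose j (by omega)
        _ ≤ 3 ^ j * (n - s).choose j := choose_two_mul_le_three_pow_mul_choose (by omega)
    calc n.choose t * (n - t).choose (s - t) * (n - t).choose j
        ≤ n.choose t * (n - t).choose (s - t) * (3 ^ j * (n - s).choose j) := Nat.mul_le_mul_left _ h3
      _ = 3 ^ j * n.choose t * ((n - t).choose (s - t) * (n - s).choose j) := by ring
      _ = 3 ^ j * n.choose t * ((n - t).choose j * (n - t - j).choose (s - t)) := by rw [hid]
      _ = 3 ^ j * n.choose t * (n - t - j).choose (s - t) * (n - t).choose j := by ring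
  exact_mod_cast key

/-- **Lower bound for the transfer constant** on balanced slices: for `64 ≤ n ≤ 4t`, `2t ≤ n`,
`8j ≤ n`: `2^n ≤ 4 · 3^j · C(n,t) · K`. [cite: ODonnell2014, §9.5] -/
theorem two_pow_le_transferConst_mul {t j : ℕ} (hn : 64 ≤ n) (hbal : n ≤ 4 * t) (h2t : 2 * t ≤ n)
    (hj : 8 * j ≤ n) : (2 : ℝ) ^ n ≤ 4 * 3 ^ j * ((n.choose t : ℕ) : ℝ) * transferConst n t j := by
  have htj : t + j ≤ n := by omega
  have hwin := two_pow_le_four_mul_sum_choose_window hn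
  have hle : ∑ s ∈ range (n + 1), (if n ≤ 2 * s ∧ 8 * s ≤ 5 * n then ((n.choose s : ℕ) : ℝ) else 0) ≤
      3 ^ j * ((n.choose t : ℕ) : ℝ) * transferConst n t j := by
    rw [transferConst, mul_sum]
    refine sum_le_sum fun s hs => ?_
    have hsn : s ≤ n := by have := mem_range.1 hs; omega
    split_ifs with h
    · exact choose_le_transferCoeff_mul (by omega) hsn h.2 hbal hj
    · exact mul_nonneg (by positivity) (transferCoeff_nonneg htj s)
  linarith

/-- `C(n,t) · t^{(j)} · (n−t)^{(j)} = C(n−2j, t−j) · n^{(2j)}` (falling factorials), for `j ≤ t`,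
`t + j ≤ n`. [cite: ODonnell2014, §1.4] -/
theorem choose_mul_descFactorial_mul_descFactorial {n t j : ℕ} (hjt : j ≤ t) (htj : t + j ≤ n) :
    n.choose t * t.descFactorial j * (n - t).descFactorial j =
      (n - 2 * j).choose (t - j) * n.descFactorial (2 * j) := by
  have hpos : 0 < (t - j).factorial * (n - t - j).factorial := by positivity
  refine Nat.eq_of_mul_eq_mul_right hpos ?_
  have lhs : n.choose t * t.descFactorial j * (n - t).descFactorial j * ((t - j).factorial * (n - t - j).factorial) =
      n.factorial := by
    have h1 := Nat.factorial_mul_descFactorial hjt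
    have h2 := Nat.factorial_mul_descFactorial (show j ≤ n - t by omega)
    have h3 := Nat.choose_mul_factorial_mul_factorial (show t ≤ n by omega)
    calc _ = n.choose t * ((t - j).factorial * t.descFactorial j) * ((n - t - j).factorial * (n - t).descFactorial j) := by ring
      _ = n.choose t * t.factorial * (n - t).factorial := by rw [h1, h2]
      _ = n.factorial := h3
  have rhs : (n - 2 * j).choose (t - j) * n.descFactorial (2 * j) * ((t - j).factorial * (n - t - j).factorial) =
      n.factorial := by
    have h1 := Nat.choose_mul_factorial_mul_factorial (show t - j ≤ n - 2 * j by omega)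
    rw [show n - 2 * j - (t - j) = n - t - j by omega] at h1
    have h2 := Nat.factorial_mul_descFactorial (show 2 * j ≤ n by omega)
    calc _ = ((n - 2 * j).choose (t - j) * (t - j).factorial * (n - t - j).factorial) * n.descFactorial (2 * j) := by ring
      _ = (n - 2 * j).factorial * n.descFactorial (2 * j) := by rw [h1]
      _ = n.factorial := h2
  rw [lhs, rhs]

/-- **The slice-norm ratio on balanced slices**: `3^j C(n,t) ≤ 64^j C(n−2j, t−j)` for `n ≤ 4t`,
`2t ≤ n`, `8j ≤ n` (i.e. `C(n,t)/C(n−2j,t−j) = n^{(2j)}/(t^{(j)} (n−t)^{(j)}) ≤ (64/3)^j`).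
[cite: ODonnell2014, §9.5] -/
theorem three_pow_mul_choose_le {t j : ℕ} (hbal : n ≤ 4 * t) (h2t : 2 * t ≤ n) (hj : 8 * j ≤ n) :
    (3 : ℝ) ^ j * ((n.choose t : ℕ) : ℝ) ≤ 64 ^ j * (((n - 2 * j).choose (t - j) : ℕ) : ℝ) := by
  have hjt : j ≤ t := by omega
  have htj : t + j ≤ n := by omega
  have hid := choose_mul_descFactorial_mul_descFactorial hjt htj
  -- lower bounds for the falling factorials of `t` and `n − t`, upper bound for that of `n`
  have h1 : (n : ℝ) ^ j ≤ 8 ^ j * (t.descFactorial j : ℝ) := by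
    have h := Nat.pow_sub_le_descFactorial t j
    have h' : ((t + 1 - j : ℕ) : ℝ) ^ j ≤ (t.descFactorial j : ℝ) := by exact_mod_cast h
    have h8 : (n : ℝ) ≤ 8 * ((t + 1 - j : ℕ) : ℝ) := by
      rw [Nat.cast_sub (by omega)]; push_cast
      have : (n : ℝ) ≤ 4 * t := by exact_mod_cast hbal
      have : 8 * (j : ℝ) ≤ n := by exact_mod_cast hj
      linarith
    calc (n : ℝ) ^ j ≤ (8 * ((t + 1 - j : ℕ) : ℝ)) ^ j := pow_le_pow_left₀ (Nat.cast_nonneg _) h8 j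
      _ = 8 ^ j * ((t + 1 - j : ℕ) : ℝ) ^ j := mul_pow _ _ _
      _ ≤ 8 ^ j * (t.descFactorial j : ℝ) := mul_le_mul_of_nonneg_left h' (by positivity)
  have h2 : (3 : ℝ) ^ j * (n : ℝ) ^ j ≤ 8 ^ j * ((n - t).descFactorial j : ℝ) := by
    have h := Nat.pow_sub_le_descFactorial (n - t) j
    have h' : ((n - t + 1 - j : ℕ) : ℝ) ^ j ≤ ((n - t).descFactorial j : ℝ) := by exact_mod_cast h
    have h8 : 3 * (n : ℝ) ≤ 8 * ((n - t + 1 - j : ℕ) : ℝ) := by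
      rw [Nat.cast_sub (by omega)]; push_cast; rw [Nat.cast_sub (by omega)]
      have : 2 * (t : ℝ) ≤ n := by exact_mod_cast h2t
      have : 8 * (j : ℝ) ≤ n := by exact_mod_cast hj
      linarith
    calc (3 : ℝ) ^ j * (n : ℝ) ^ j = (3 * (n : ℝ)) ^ j := (mul_pow _ _ _).symm
      _ ≤ (8 * ((n - t + 1 - j : ℕ) : ℝ)) ^ j := pow_le_pow_left₀ (by positivity) h8 j
      _ = 8 ^ j * ((n - t + 1 - j : ℕ) : ℝ) ^ j := mul_pow _ _ _
      _ ≤ 8 ^ j * ((n - t).descFactorial j : ℝ) := mul_le_mul_of_nonneg_left h' (by positivity)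
  have h3 : (n.descFactorial (2 * j) : ℝ) ≤ (n : ℝ) ^ (2 * j) := by exact_mod_cast Nat.descFactorial_le_pow n (2 * j)
  have hidR : ((n.choose t : ℕ) : ℝ) * (t.descFactorial j : ℝ) * ((n - t).descFactorial j : ℝ) =
      (((n - 2 * j).choose (t - j) : ℕ) : ℝ) * (n.descFactorial (2 * j) : ℝ) := by exact_mod_cast hid
  -- combine: `3^j n^{2j} C(n,t) ≤ 64^j C(n,t) t^{(j)} (n−t)^{(j)} = 64^j C(n−2j,t−j) n^{(2j)} ≤ 64^j C(n−2j,t−j) n^{2j}`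
  rcases Nat.eq_zero_or_pos n with hn0 | hnpos
  · subst hn0
    have : j = 0 := by omega
    subst this; simp
  have hnj : (0 : ℝ) < (n : ℝ) ^ (2 * j) := by positivity
  refine le_of_mul_le_mul_right ?_ hnj
  calc (3 : ℝ) ^ j * ((n.choose t : ℕ) : ℝ) * (n : ℝ) ^ (2 * j)
      = ((n.choose t : ℕ) : ℝ) * ((n : ℝ) ^ j) * (3 ^ j * (n : ℝ) ^ j) := by rw [pow_mul']; ring
    _ ≤ ((n.choose t : ℕ) : ℝ) * (8 ^ j * (t.descFactorial j : ℝ)) * (8 ^ j * ((n - t).descFactorial j : ℝ)) := by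
        gcongr
    _ = 64 ^ j * (((n.choose t : ℕ) : ℝ) * (t.descFactorial j : ℝ) * ((n - t).descFactorial j : ℝ)) := by
        rw [show (64 : ℝ) ^ j = 8 ^ j * 8 ^ j by rw [← mul_pow]; norm_num]; ring
    _ = 64 ^ j * ((((n - 2 * j).choose (t - j) : ℕ) : ℝ) * (n.descFactorial (2 * j) : ℝ)) := by rw [hidR]
    _ ≤ 64 ^ j * ((((n - 2 * j).choose (t - j) : ℕ) : ℝ) * (n : ℝ) ^ (2 * j)) := by gcongr
    _ = 64 ^ j * (((n - 2 * j).choose (t - j) : ℕ) : ℝ) * (n : ℝ) ^ (2 * j) := by ring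

/-- **The transfer factor on balanced slices**: for `64 ≤ n ≤ 4t`, `2t ≤ n`, `8j ≤ n`,
`Λ = transferLambda n t j ≤ 16 · 48^j · C(n,t)`. [cite: ODonnell2014, §9.5] -/
theorem transferLambda_le {t j : ℕ} (hn : 64 ≤ n) (hbal : n ≤ 4 * t) (h2t : 2 * t ≤ n) (hj : 8 * j ≤ n) :
    transferLambda n t j ≤ 16 * 48 ^ j * ((n.choose t : ℕ) : ℝ) := by
  have hjt : j ≤ t := by omega
  have htj : t + j ≤ n := by omega
  set K := transferConst n t j with hK_def
  have hK : 0 < K := lt_of_lt_of_le zero_lt_one (one_le_transferConst htj)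
  have hKlow := two_pow_le_transferConst_mul hn hbal h2t hj
  have hratio := three_pow_mul_choose_le (n := n) hbal h2t hj
  have hct : (0 : ℝ) < ((n.choose t : ℕ) : ℝ) := by exact_mod_cast Nat.choose_pos (by omega)
  -- `(t−j)!/ff(n−2j,t−j) = 1/C(n−2j,t−j)`
  have hff : ff ((n : ℝ) - 2 * j) (t - j) = ((t - j).factorial : ℝ) * (((n - 2 * j).choose (t - j) : ℕ) : ℝ) := by
    rw [show ((n : ℝ) - 2 * j) = ((n - 2 * j : ℕ) : ℝ) by rw [Nat.cast_sub (by omega)]; push_cast; ring,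
      ← ff_natCast_div_factorial]
    field_simp
  have hcpos : (0 : ℝ) < (((n - 2 * j).choose (t - j) : ℕ) : ℝ) := by
    exact_mod_cast Nat.choose_pos (by omega)
  have hΛ : transferLambda n t j = (4 : ℝ) ^ (n - j) / (K ^ 2 * (((n - 2 * j).choose (t - j) : ℕ) : ℝ)) := by
    rw [transferLambda, ← hK_def, hff]
    field_simp
  rw [hΛ, div_le_iff₀ (by positivity)]
  -- `4^{n−j} · (3·C(n,t)) ... `: from `2^n ≤ 4·3^j·C(n,t)·K` squared and `3^j C(n,t) ≤ 64^j C(n−2j,t−j)`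
  have hsq : (4 : ℝ) ^ n ≤ (4 * 3 ^ j * ((n.choose t : ℕ) : ℝ) * K) ^ 2 := by
    rw [show (4 : ℝ) ^ n = (2 ^ n) ^ 2 by rw [← pow_mul, mul_comm, pow_mul]; norm_num]
    exact pow_le_pow_left₀ (by positivity) hKlow 2
  have h4 : (4 : ℝ) ^ (n - j) * 4 ^ j = 4 ^ n := by rw [← pow_add, Nat.sub_add_cancel (by omega)]
  -- multiply the target by `4^j > 0`
  have h4j : (0 : ℝ) < 4 ^ j := by positivity
  refine le_of_mul_le_mul_right ?_ h4j
  rw [h4]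
  calc (4 : ℝ) ^ n ≤ (4 * 3 ^ j * ((n.choose t : ℕ) : ℝ) * K) ^ 2 := hsq
    _ = 16 * ((n.choose t : ℕ) : ℝ) * K ^ 2 * (3 ^ j * (3 ^ j * ((n.choose t : ℕ) : ℝ))) := by ring
    _ ≤ 16 * ((n.choose t : ℕ) : ℝ) * K ^ 2 * (3 ^ j * (64 ^ j * (((n - 2 * j).choose (t - j) : ℕ) : ℝ))) := by
        gcongr
    _ = 16 * 48 ^ j * ((n.choose t : ℕ) : ℝ) * (K ^ 2 * (((n - 2 * j).choose (t - j) : ℕ) : ℝ)) * 4 ^ j := by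
        have e64 : (64 : ℝ) ^ j = 16 ^ j * 4 ^ j := by rw [← mul_pow]; norm_num
        have e48 : (48 : ℝ) ^ j = 3 ^ j * 16 ^ j := by rw [← mul_pow]; norm_num
        rw [e64, e48]; ring

/-- **The level-`j` inequality on balanced slices with absolute constants** (`j ≥ 1`, `64 ≤ n ≤ 4t`,
`2t ≤ n`, `8j ≤ n`): for `0 ≤ f ≤ 1` on the `t`-sets with mean `μ` and every harmonic `q` of degree `j`,
`⟨f, zeta q⟩² ≤ 16 · C(n,t) · μ² · (48 e (2 ln(1/μ)/j + 3))^j · Σ_{|U|=t} (zeta q U)²`, i.e.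
`W_j[f] ≤ 16 μ² (48 e (2 ln(1/μ)/j + 3))^j`. [cite: ODonnell2014, §9.5] -/
theorem slice_level_sq_le_log_balanced {j t : ℕ} (hn : 64 ≤ n) (hbal : n ≤ 4 * t) (h2t : 2 * t ≤ n)
    (hj1 : 1 ≤ j) (hj : 8 * j ≤ n) {q : Finset (Fin n) → ℝ} (hq : IsHarmonic j q) (f : Finset (Fin n) → ℝ)
    (hf0 : ∀ U : Finset (Fin n), U.card = t → 0 ≤ f U) (hf1 : ∀ U : Finset (Fin n), U.card = t → f U ≤ 1) :
    (∑ U ∈ powersetCard t univ, f U * zeta q U) ^ 2 ≤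
      16 * ((n.choose t : ℕ) : ℝ) * sliceMean n t f ^ 2 *
        (48 * (Real.exp 1 * (2 * Real.log (1 / sliceMean n t f) / j + 3))) ^ j *
        ∑ U ∈ powersetCard t univ, zeta q U ^ 2 := by
  have hjt : j ≤ t := by omega
  have htj : t + j ≤ n := by omega
  have h := slice_level_sq_le_log hj1 hjt htj hq f hf0 hf1
  have hΛ := transferLambda_le hn hbal h2t hj
  have hμ0 : 0 ≤ sliceMean n t f := sliceMean_nonneg hf0
  have hμ1 : sliceMean n t f ≤ 1 := sliceMean_le_one hf1
  have hL : 0 ≤ 2 * Real.log (1 / sliceMean n t f) / j + 3 := by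
    rcases hμ0.eq_or_lt with hz | hpos
    · rw [← hz]; simp
    · have : 0 ≤ Real.log (1 / sliceMean n t f) :=
        Real.log_nonneg (by rw [le_div_iff₀ hpos, one_mul]; exact hμ1)
      positivity
  calc (∑ U ∈ powersetCard t univ, f U * zeta q U) ^ 2
      ≤ transferLambda n t j * sliceMean n t f ^ 2 *
          (Real.exp 1 * (2 * Real.log (1 / sliceMean n t f) / j + 3)) ^ j *
          ∑ U ∈ powersetCard t univ, zeta q U ^ 2 := h
    _ ≤ (16 * 48 ^ j * ((n.choose t : ℕ) : ℝ)) * sliceMean n t f ^ 2 *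
          (Real.exp 1 * (2 * Real.log (1 / sliceMean n t f) / j + 3)) ^ j *
          ∑ U ∈ powersetCard t univ, zeta q U ^ 2 := by
        gcongr
    _ = 16 * ((n.choose t : ℕ) : ℝ) * sliceMean n t f ^ 2 *
        (48 * (Real.exp 1 * (2 * Real.log (1 / sliceMean n t f) / j + 3))) ^ j *
        ∑ U ∈ powersetCard t univ, zeta q U ^ 2 := by
        rw [mul_pow (48 : ℝ)]; ring

/-! ### §7 Projection form: the norm of a harmonic layer of `f`

If `f` is written on the `t`-slice as a sum of harmonic layers `f = Σ_{i ≤ t} zeta p_i` (the tree's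
`exists_ladder_decomposition` / `exists_harmonic_decomposition`, with the factorials `(t−i)!` absorbed into the
`p_i`), then testing against `q := p_j` isolates the layer (different degrees are orthogonal on every slice,
`slice_sum_zeta_mul_zeta_cross`), and the level-`j` inequality bounds the NORM of the layer:
`‖f^{=j}‖² = Σ_{|U|=t} (zeta p_j U)² ≤ Λ μ² (e(2 ln(1/μ)/j+3))^j`, i.e. `W_j[f] ≤ (Λ/C(n,t)) μ² (…)^j`. -/

/-- Testing a layer decomposition against one of its layers returns that layer's norm:
`Σ_{|U|=t} f(U)·zeta p_j U = Σ_{|U|=t} (zeta p_j U)²` for `f = Σ_{i≤t} zeta p_i` on the `t`-sets, `j ≤ t`.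
[cite: Filmus2016, Thm. 3.1 (arXiv p. 6)] -/
theorem sum_mul_zeta_layer_eq_sq {t j : ℕ} (hjt : j ≤ t) (p : ℕ → Finset (Fin n) → ℝ)
    (hp : ∀ i, IsHarmonic i (p i)) (f : Finset (Fin n) → ℝ)
    (hdec : ∀ U ∈ powersetCard t (univ : Finset (Fin n)), f U = ∑ i ∈ range (t + 1), zeta (p i) U) :
    ∑ U ∈ powersetCard t univ, f U * zeta (p j) U = ∑ U ∈ powersetCard t univ, zeta (p j) U ^ 2 := by
  calc ∑ U ∈ powersetCard t univ, f U * zeta (p j) U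
      = ∑ U ∈ powersetCard t univ, ∑ i ∈ range (t + 1), zeta (p i) U * zeta (p j) U := by
        refine sum_congr rfl fun U hU => ?_
        rw [hdec U hU, sum_mul]
    _ = ∑ i ∈ range (t + 1), ∑ U ∈ powersetCard t univ, zeta (p i) U * zeta (p j) U := sum_comm
    _ = ∑ i ∈ range (t + 1), (if i = j then ∑ U ∈ powersetCard t univ, zeta (p j) U ^ 2 else 0) := by
        refine sum_congr rfl fun i _ => ?_
        split_ifs with hij
        · subst hij
          exact sum_congr rfl fun U _ => (sq _).symm
        · exact slice_sum_zeta_mul_zeta_cross (hp i) (hp j) hij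
    _ = ∑ U ∈ powersetCard t univ, zeta (p j) U ^ 2 := by
        rw [sum_ite_eq' (range (t + 1)) j, if_pos (mem_range.2 (by omega))]

/-- **Projection form of the level-`j` inequality**: for `0 ≤ f ≤ 1` on the `t`-sets with mean `μ`, written
there as a sum of harmonic layers `f = Σ_{i≤t} zeta p_i`, and `1 ≤ j ≤ t`, `t + j ≤ n`:
`Σ_{|U|=t} (zeta p_j U)² ≤ Λ · μ² · (e (2 ln(1/μ)/j + 3))^j` — the norm of the degree-`j` layer itself.
[cite: ODonnell2014, §9.5] -/
theorem slice_layer_sq_le_log {j t : ℕ} (hj : 1 ≤ j) (hjt : j ≤ t) (htj : t + j ≤ n)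
    (p : ℕ → Finset (Fin n) → ℝ) (hp : ∀ i, IsHarmonic i (p i)) (f : Finset (Fin n) → ℝ)
    (hf0 : ∀ U : Finset (Fin n), U.card = t → 0 ≤ f U) (hf1 : ∀ U : Finset (Fin n), U.card = t → f U ≤ 1)
    (hdec : ∀ U ∈ powersetCard t (univ : Finset (Fin n)), f U = ∑ i ∈ range (t + 1), zeta (p i) U) :
    ∑ U ∈ powersetCard t univ, zeta (p j) U ^ 2 ≤
      transferLambda n t j * sliceMean n t f ^ 2 *
        (Real.exp 1 * (2 * Real.log (1 / sliceMean n t f) / j + 3)) ^ j := by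
  set N := ∑ U ∈ powersetCard t univ, zeta (p j) U ^ 2 with hN_def
  set B := transferLambda n t j * sliceMean n t f ^ 2 *
    (Real.exp 1 * (2 * Real.log (1 / sliceMean n t f) / j + 3)) ^ j with hB_def
  have h := slice_level_sq_le_log hj hjt htj (hp j) f hf0 hf1
  rw [sum_mul_zeta_layer_eq_sq hjt p hp f hdec, ← hN_def] at h
  -- `h : N² ≤ B·N`
  have hN0 : 0 ≤ N := sum_nonneg fun U _ => sq_nonneg _
  have hμ0 : 0 ≤ sliceMean n t f := sliceMean_nonneg hf0
  have hμ1 : sliceMean n t f ≤ 1 := sliceMean_le_one hf1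
  have hB0 : 0 ≤ B := by
    have hL : 0 ≤ 2 * Real.log (1 / sliceMean n t f) / j + 3 := by
      rcases hμ0.eq_or_lt with hz | hpos
      · rw [← hz]; simp
      · have : 0 ≤ Real.log (1 / sliceMean n t f) :=
          Real.log_nonneg (by rw [le_div_iff₀ hpos, one_mul]; exact hμ1)
        positivity
    have := transferLambda_pos hjt htj
    positivity
  rcases hN0.eq_or_lt with hz | hpos
  · rw [← hz]; exact hB0
  · have h' : N * N ≤ B * N := by rw [← sq]; linarith
    exact le_of_mul_le_mul_right h' hpos

/-- **Projection form on balanced slices, absolute constants**: for `64 ≤ n ≤ 4t`, `2t ≤ n`, `1 ≤ j ≤ n/8`,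
`0 ≤ f ≤ 1` on the `t`-sets with mean `μ` and harmonic layers `f = Σ_{i≤t} zeta p_i` there:
`Σ_{|U|=t} (zeta p_j U)² ≤ 16 · C(n,t) · μ² · (48 e (2 ln(1/μ)/j + 3))^j`, i.e.
`W_j[f] = ‖f^{=j}‖²/C(n,t) ≤ 16 μ² (48 e (2 ln(1/μ)/j + 3))^j`. [cite: ODonnell2014, §9.5] -/
theorem slice_layer_sq_le_log_balanced {j t : ℕ} (hn : 64 ≤ n) (hbal : n ≤ 4 * t) (h2t : 2 * t ≤ n)
    (hj1 : 1 ≤ j) (hj : 8 * j ≤ n) (p : ℕ → Finset (Fin n) → ℝ) (hp : ∀ i, IsHarmonic i (p i))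
    (f : Finset (Fin n) → ℝ) (hf0 : ∀ U : Finset (Fin n), U.card = t → 0 ≤ f U)
    (hf1 : ∀ U : Finset (Fin n), U.card = t → f U ≤ 1)
    (hdec : ∀ U ∈ powersetCard t (univ : Finset (Fin n)), f U = ∑ i ∈ range (t + 1), zeta (p i) U) :
    ∑ U ∈ powersetCard t univ, zeta (p j) U ^ 2 ≤
      16 * ((n.choose t : ℕ) : ℝ) * sliceMean n t f ^ 2 *
        (48 * (Real.exp 1 * (2 * Real.log (1 / sliceMean n t f) / j + 3))) ^ j := by
  have hjt : j ≤ t := by omega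
  have htj : t + j ≤ n := by omega
  have h := slice_layer_sq_le_log hj1 hjt htj p hp f hf0 hf1 hdec
  have hΛ := transferLambda_le hn hbal h2t hj
  have hμ0 : 0 ≤ sliceMean n t f := sliceMean_nonneg hf0
  have hμ1 : sliceMean n t f ≤ 1 := sliceMean_le_one hf1
  have hL : 0 ≤ 2 * Real.log (1 / sliceMean n t f) / j + 3 := by
    rcases hμ0.eq_or_lt with hz | hpos
    · rw [← hz]; simp
    · have : 0 ≤ Real.log (1 / sliceMean n t f) :=
        Real.log_nonneg (by rw [le_div_iff₀ hpos, one_mul]; exact hμ1)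
      positivity
  calc ∑ U ∈ powersetCard t univ, zeta (p j) U ^ 2
      ≤ transferLambda n t j * sliceMean n t f ^ 2 *
          (Real.exp 1 * (2 * Real.log (1 / sliceMean n t f) / j + 3)) ^ j := h
    _ ≤ (16 * 48 ^ j * ((n.choose t : ℕ) : ℝ)) * sliceMean n t f ^ 2 *
          (Real.exp 1 * (2 * Real.log (1 / sliceMean n t f) / j + 3)) ^ j := by gcongr
    _ = 16 * ((n.choose t : ℕ) : ℝ) * sliceMean n t f ^ 2 *
        (48 * (Real.exp 1 * (2 * Real.log (1 / sliceMean n t f) / j + 3))) ^ j := by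
        rw [mul_pow (48 : ℝ)]; ring

end SliceLevelInequality

end Literature.Combinatorics.AssociationSchemes
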